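import Literature.ModelTheory.Zilber.EACQuadricBases
import Literature.ModelTheory.Zilber.EACSubcellCertificates
import Literature.ModelTheory.Zilber.EACDensityProofs
import HarnessLib

/-!
# EAC ladder — cell-membership certificates for graph-fibre varieties `W(g; P)`

Typed support for the ladder of Zilber's Exponential-Algebraic-Closedness conjecture
(`Literature.ModelTheory.Zilber.EAC`, cells `ECCell n d`; first open rung `ECCell 3 2 =
ECCellAperiodic 2 ∧ ECCellPeriodic 2`, `EACAperiodicBase.ecCell_three_two_iff`).

The problem-side escape theorems of `Summits/Schanuel/Schanuel/Theorems/ZilberEacComplexQuadricEscape*`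
solve systems `exp xⱼ = Pⱼ(e^{g(x)}, x)` (`j ≤ s`) for a quadric `g` and fibre polynomials
`Pⱼ ∈ ℂ[u, x']`: monomial fibres `cⱼ u^{κⱼ} + Aⱼ(x')`, and "Laurent" fibres
`u^{κⱼ}(cⱼ + Σ_{i<K} A_{j,i}(x') u^{-(i+1)})` (`K ≤ κⱼ`). As subsets of `ℂⁿ × ℂⁿ` (`n = s + 1`) these
are the **graph-fibre varieties** `W(g; P) = {xₙ = g(x'), yⱼ = Pⱼ(yₙ, x') (j ≤ s)}`. This file certifies
WHEN such a `W(g; P)` satisfies the seven hypotheses of `ECCell (s+1) s` (resp. the binders of the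
sub-cells `ECCellAperiodic s` / `ECCellPeriodic s`), so that each solved family is a certified member of
the open cell and not merely an existence statement about a system of equations:

* `graphFibreVariety_eq_polyFibredGraph`: `W(g; P) = W(g; P(0,·), (P - P(0,·))/u)` — every graph-fibre
  variety is a poly-fibred graph of `EACRotundityProofs` (so irreducibility, `dim = n` are inherited);
* `mulSubstInjective_of_fibreAt` (the one new algebraic lemma): the multiplicative substitution
  `τ : Yⱼ ↦ P̃ⱼ, Yₙ ↦ U` is injective — i.e. the multiplicative projection of `W ∩ Gⁿ` is dominant —
  as soon as ONE slice `x' ↦ P(u₀, x')` is a dominant self-map of `ℂˢ` (the criterion of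
  `EACRotundityProofs.aeval_pMulSubst_injective` is the slice `u₀ = 0`; monomial and Laurent fibres have
  zero `u⁰`-part, so the old criterion does not apply to them, the new one does with any `u₀ ≠ 0`);
* the binders of `W(g; A, F)` under injectivity of `τ` alone (`…_of_injective`), and the resulting
  certificates `ecCell_hypotheses_graphFibreVariety`, `ecCellAperiodic_hypotheses_graphFibreVariety`,
  `ecCellPeriodic_hypotheses_graphFibreVariety` + the `ECCell… → (W ∩ Γ_exp ≠ ∅)` corollaries and the
  dictionary `graphFibreVariety_inter_expGraph_nonempty_iff` (exponential points ↔ solutions);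
* `two_le_totalDegree_quadPoly`: a quadric with `M + Mᵀ ≠ 0` has total degree `≥ 2` (additive freeness),
  via the general `eval_add_add_eval_zero_of_totalDegree_le_one` (degree `≤ 1` ⇒ affine function);
* the two problem-side families verbatim: `powerFibreVariety` (= the set of
  `Summit.….quadricEscapePowers_inter_expGraph_nonempty`; `κ ≡ 1` is the matrix escape family) and
  `laurentFibreVariety` (polynomial form; equal ON THE TORUS to the inverse-power set of
  `Summit.….quadricEscapeLaurent_inter_expGraph_nonempty` when `K ≤ κⱼ`,
  `laurentFibreVariety_inter_torusLocus_eq`), with their certificates: dominant `A` (resp. a dominant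
  slice `Σᵢ u₀^{κⱼ-i-1} A_{j,i}`), `M + Mᵀ ≠ 0` (implied by the escape hypothesis `κᵀMκ ≠ 0`,
  `exists_add_ne_zero_of_quadForm_ne_zero`), and the (a)periodicity test of
  `EACQuadricBases.hasIntegerPeriod_graphBase_quadPoly_iff` deciding the sub-cell.

HONEST FRAMING. Bookkeeping for modest rungs of EAC: nothing here proves a case of EAC (the
exponential points are found problem-side), `ECCell 3 2` and both its sub-cells remain OPEN, and
nothing here bears on Schanuel's conjecture (EAC is a different statement; EAC ⇏ SC).

Sources: Mantova–Masser 2024 (MantovaMasser2023, arXiv:2303.05592) §1 p. 5 (the open case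
`dim π(V) = 2` in `ℂ³ × (ℂˣ)³` and its model system); Aslanyan–Gallinaro 2024 (arXiv:2409.12860)
Def. 3.3, §3.4; Zilber 2005 §3 (freeness, rotundity); Bays–Kirby 2018 Def. 7.1.
-/

noncomputable section

open MvPolynomial

namespace Literature.ModelTheory.Zilber

open Literature.NumberTheory.Transcendental

/-! ### Binders of `W(g; A, F)` from injectivity of the multiplicative substitution alone -/

section InjectiveSubst

variable {s : ℕ} (g : MvPolynomial (Fin s) ℂ) (A : Fin s → MvPolynomial (Fin s) ℂ)
  (F : Fin s → MvPolynomial (Fin (s + 1)) ℂ)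

/-- **Injectivity of the multiplicative substitution** `τ : ℂ[Y] → ℂ[x', u]`,
`Yⱼ ↦ Ãⱼ + U F̃ⱼ` (`j ≤ s`), `Yₙ ↦ U`, of the poly-fibred graph `W(g; A, F)`: algebraically, "the
multiplicative projection of `W ∩ Gⁿ` is dominant". [folklore] -/
def MulSubstInjective : Prop :=
  Function.Injective (aeval (pMulSubst A F) :
    MvPolynomial (Fin (s + 1)) ℂ →ₐ[ℂ] MvPolynomial (Fin (s + 1)) ℂ)

/-- The criterion of `EACRotundityProofs`: a dominant `u⁰`-part `A` suffices. [folklore] -/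
theorem mulSubstInjective_of_dominant
    (hA : Function.Injective (aeval A : MvPolynomial (Fin s) ℂ →ₐ[ℂ] MvPolynomial (Fin s) ℂ)) :
    MulSubstInjective A F :=
  aeval_pMulSubst_injective A F hA

/-- If `τ` is injective its coordinate polynomials are nonzero (`τ Yᵢ ≠ τ 0`). [folklore] -/
theorem pMulSubst_ne_zero_of_injective (hτ : MulSubstInjective A F) (i : Fin (s + 1)) :
    pMulSubst A F i ≠ 0 := by
  intro h0
  have h1 : aeval (pMulSubst A F) (X i : MvPolynomial (Fin (s + 1)) ℂ) =
      aeval (pMulSubst A F) (0 : MvPolynomial (Fin (s + 1)) ℂ) := by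
    rw [aeval_X, h0, map_zero]
  exact X_ne_zero i (hτ h1)

/-- Hence `∏ᵢ τ(Yᵢ) ≠ 0`. [folklore] -/
theorem prod_pMulSubst_ne_zero_of_injective (hτ : MulSubstInjective A F) :
    (∏ i, pMulSubst A F i) ≠ 0 :=
  Finset.prod_ne_zero_iff.2 fun i _ => pMulSubst_ne_zero_of_injective A F hτ i

/-- `W(g; A, F)` meets the torus (`τ` injective). [folklore] -/
theorem polyFibredGraph_inter_torusLocus_nonempty_of_injective (hτ : MulSubstInjective A F) :
    (polyFibredGraph g A F ∩ torusLocus ℂ (s + 1)).Nonempty := by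
  have hU := prod_pMulSubst_ne_zero_of_injective A F hτ
  obtain ⟨c, hc⟩ : ∃ c : Fin (s + 1) → ℂ, eval c (∏ i, pMulSubst A F i) ≠ 0 := by
    by_contra h
    simp only [not_exists, not_not] at h
    exact hU (MvPolynomial.funext fun c => by rw [h c, map_zero])
  exact ⟨_, pgParam_mem g A F _ _, pgParam_mem_torusLocus_of_eval_ne_zero g A F hc⟩

/-- **The multiplicative projection of `W(g; A, F) ∩ Gⁿ` is dominant** (`τ` injective).
[folklore] -/
theorem hasDominantMulProjection_polyFibredGraph_of_injective (hτ : MulSubstInjective A F) :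
    HasDominantMulProjection ℂ (polyFibredGraph g A F ∩ torusLocus ℂ (s + 1)) := by
  intro p hp
  have hPU : aeval (pMulSubst A F) p * ∏ i, pMulSubst A F i = 0 := by
    apply MvPolynomial.funext
    intro c
    rw [map_zero, map_mul]
    by_cases hc : eval c (∏ i, pMulSubst A F i) = 0
    · rw [hc, mul_zero]
    · have hT := pgParam_mem_torusLocus_of_eval_ne_zero g A F hc
      have h0 := hp _ ⟨pgParam_mem g A F _ _, hT⟩
      rw [projMul_pgParam] at h0
      rw [eval_aeval_pMulSubst, h0, zero_mul]
  have hP : aeval (pMulSubst A F) p = 0 :=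
    (mul_eq_zero.1 hPU).resolve_right (prod_pMulSubst_ne_zero_of_injective A F hτ)
  exact (injective_iff_map_eq_zero _).1 hτ p hP

/-- `W(g; A, F) ∩ Gⁿ` is multiplicatively free (`τ` injective). [folklore] -/
theorem isMulFree_polyFibredGraph_of_injective (hτ : MulSubstInjective A F) :
    IsMulFree ℂ (s + 1) (polyFibredGraph g A F ∩ torusLocus ℂ (s + 1)) :=
  isMulFree_of_hasDominantMulProjection Set.inter_subset_right
    (hasDominantMulProjection_polyFibredGraph_of_injective g A F hτ)

/-- **`W(g; A, F) ∩ Gⁿ` is rotund** (`τ` injective). [folklore] -/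
theorem isRotund_polyFibredGraph_of_injective (hτ : MulSubstInjective A F) :
    IsRotund ℂ (s + 1) (polyFibredGraph g A F ∩ torusLocus ℂ (s + 1)) :=
  isRotund_of_hasDominantMulProjection (isIrreducibleClosed_polyFibredGraph g A F)
    (polyFibredGraph_inter_torusLocus_nonempty_of_injective g A F hτ)
    (hasDominantMulProjection_polyFibredGraph_of_injective g A F hτ)

/-- **`I(π(W(g; A, F) ∩ Gⁿ)) = ker (Xₙ ↦ g)`** (`τ` injective). [folklore] -/
theorem vanishingIdeal_projAdd_polyFibredGraph_of_injective (hτ : MulSubstInjective A F) :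
    vanishingIdeal ℂ (projAdd '' (polyFibredGraph g A F ∩ torusLocus ℂ (s + 1))) =
      RingHom.ker (aeval (graphSubst g) :
        MvPolynomial (Fin (s + 1)) ℂ →ₐ[ℂ] MvPolynomial (Fin s) ℂ) := by
  ext p
  rw [mem_vanishingIdeal_iff, RingHom.mem_ker]
  constructor
  · intro hp
    have hPU : rename Fin.castSucc (aeval (graphSubst g) p) * ∏ i, pMulSubst A F i = 0 := by
      apply MvPolynomial.funext
      intro c
      rw [map_zero, map_mul]
      by_cases hc : eval c (∏ i, pMulSubst A F i) = 0
      · rw [hc, mul_zero]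
      · have hT := pgParam_mem_torusLocus_of_eval_ne_zero g A F hc
        have h0 := hp _ ⟨_, ⟨pgParam_mem g A F _ _, hT⟩, rfl⟩
        rw [projAdd_pgParam, ← eval_aeval_graphSubst] at h0
        have hcomp : (c ∘ Fin.castSucc) = Fin.init c := rfl
        rw [eval_rename, hcomp, h0, zero_mul]
    have hP := (mul_eq_zero.1 hPU).resolve_right (prod_pMulSubst_ne_zero_of_injective A F hτ)
    exact rename_injective _ (Fin.castSucc_injective s) (by rw [hP, map_zero])
  · intro hp
    rintro _ ⟨z, ⟨hz, -⟩, rfl⟩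
    rw [eq_pgParam_of_mem g A F hz, projAdd_pgParam, ← eval_aeval_graphSubst, hp, map_zero]

/-- **`dim cl π(W(g; A, F) ∩ Gⁿ) = s`** (`τ` injective). [folklore] -/
theorem addProjDim_polyFibredGraph_of_injective (hτ : MulSubstInjective A F) :
    addProjDim ℂ (s + 1) (polyFibredGraph g A F) = (s : ℕ) := by
  unfold addProjDim zariskiDim
  rw [vanishingIdeal_projAdd_polyFibredGraph_of_injective g A F hτ,
    ringKrullDim_eq_of_ringEquiv
      (Ideal.quotientKerAlgEquivOfSurjective (graphSubst_surjective g)).toRingEquiv,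
    MvPolynomial.ringKrullDim_of_isNoetherianRing, ringKrullDim_eq_zero_of_field,
    Nat.card_eq_fintype_card, Fintype.card_fin, zero_add]

/-- `W(g; A, F) ∩ Gⁿ` is additively free (`τ` injective, `deg g ≥ 2`). [folklore] -/
theorem isAddFree_polyFibredGraph_of_injective (hτ : MulSubstInjective A F)
    (hg : 2 ≤ g.totalDegree) :
    IsAddFree ℂ (s + 1) (polyFibredGraph g A F ∩ torusLocus ℂ (s + 1)) :=
  isAddFree_of_vanishingIdeal_projAdd_eq_ker g
    (vanishingIdeal_projAdd_polyFibredGraph_of_injective g A F hτ) hg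

/-- The base of `W(g; A, F) ∩ Gⁿ` is periodic iff `graphBase g` is (`τ` injective). [folklore] -/
theorem hasIntegerPeriod_projAdd_polyFibredGraph_iff_of_injective (hτ : MulSubstInjective A F) :
    HasIntegerPeriod ℂ (projAdd '' (polyFibredGraph g A F ∩ torusLocus ℂ (s + 1))) ↔
      HasIntegerPeriod ℂ (graphBase g) :=
  hasIntegerPeriod_congr (by rw [vanishingIdeal_projAdd_polyFibredGraph_of_injective g A F hτ,
    vanishingIdeal_graphBase])

/-- **`W(g; A, F)` satisfies the seven hypotheses of `ECCell (s+1) s`** (`τ` injective,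
`deg g ≥ 2`), in the order of the binders. [folklore] -/
theorem ecCell_hypotheses_polyFibredGraph_of_injective (hτ : MulSubstInjective A F)
    (hg : 2 ≤ g.totalDegree) :
    IsIrreducibleClosed ℂ (polyFibredGraph g A F) ∧
    (polyFibredGraph g A F ∩ torusLocus ℂ (s + 1)).Nonempty ∧
    IsRotund ℂ (s + 1) (polyFibredGraph g A F ∩ torusLocus ℂ (s + 1)) ∧
    IsAddFree ℂ (s + 1) (polyFibredGraph g A F ∩ torusLocus ℂ (s + 1)) ∧
    IsMulFree ℂ (s + 1) (polyFibredGraph g A F ∩ torusLocus ℂ (s + 1)) ∧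
    zariskiDim ℂ (polyFibredGraph g A F) = (s + 1 : ℕ) ∧
    addProjDim ℂ (s + 1) (polyFibredGraph g A F) = (s : ℕ) :=
  ⟨isIrreducibleClosed_polyFibredGraph g A F,
    polyFibredGraph_inter_torusLocus_nonempty_of_injective g A F hτ,
    isRotund_polyFibredGraph_of_injective g A F hτ, isAddFree_polyFibredGraph_of_injective g A F hτ hg,
    isMulFree_polyFibredGraph_of_injective g A F hτ, zariskiDim_polyFibredGraph g A F,
    addProjDim_polyFibredGraph_of_injective g A F hτ⟩

/-- **`τ` injective, `s ≥ 1`, `graphBase g` aperiodic ⇒ member of `ECCellAperiodic s`** (the seven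
binders in order; additive freeness is automatic, `isAddFree_of_not_hasIntegerPeriod`). [folklore] -/
theorem ecCellAperiodic_hypotheses_polyFibredGraph_of_injective (hτ : MulSubstInjective A F)
    (hs : 0 < s) (haper : ¬ HasIntegerPeriod ℂ (graphBase g)) :
    IsIrreducibleClosed ℂ (polyFibredGraph g A F) ∧
    (polyFibredGraph g A F ∩ torusLocus ℂ (s + 1)).Nonempty ∧
    IsAddFree ℂ (s + 1) (polyFibredGraph g A F ∩ torusLocus ℂ (s + 1)) ∧
    IsMulFree ℂ (s + 1) (polyFibredGraph g A F ∩ torusLocus ℂ (s + 1)) ∧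
    zariskiDim ℂ (polyFibredGraph g A F) = (s + 1 : ℕ) ∧
    addProjDim ℂ (s + 1) (polyFibredGraph g A F) = (s : ℕ) ∧
    ¬ HasIntegerPeriod ℂ (projAdd '' (polyFibredGraph g A F ∩ torusLocus ℂ (s + 1))) := by
  have hper : ¬ HasIntegerPeriod ℂ (projAdd '' (polyFibredGraph g A F ∩ torusLocus ℂ (s + 1))) := by
    rw [hasIntegerPeriod_projAdd_polyFibredGraph_iff_of_injective g A F hτ]
    exact haper
  have hirr := isIrreducibleClosed_polyFibredGraph g A F
  have hne := polyFibredGraph_inter_torusLocus_nonempty_of_injective g A F hτ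
  have hbase := addProjDim_polyFibredGraph_of_injective g A F hτ
  exact ⟨hirr, hne, isAddFree_of_not_hasIntegerPeriod hirr hne hs hbase hper,
    isMulFree_polyFibredGraph_of_injective g A F hτ, zariskiDim_polyFibredGraph g A F, hbase, hper⟩

/-- **`τ` injective, `deg g ≥ 2`, `graphBase g` periodic ⇒ member of `ECCellPeriodic s`** (the
eight binders in order; rotundity from the dominant multiplicative projection). [folklore] -/
theorem ecCellPeriodic_hypotheses_polyFibredGraph_of_injective (hτ : MulSubstInjective A F)
    (hg : 2 ≤ g.totalDegree) (hper : HasIntegerPeriod ℂ (graphBase g)) :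
    IsIrreducibleClosed ℂ (polyFibredGraph g A F) ∧
    (polyFibredGraph g A F ∩ torusLocus ℂ (s + 1)).Nonempty ∧
    IsRotund ℂ (s + 1) (polyFibredGraph g A F ∩ torusLocus ℂ (s + 1)) ∧
    IsAddFree ℂ (s + 1) (polyFibredGraph g A F ∩ torusLocus ℂ (s + 1)) ∧
    IsMulFree ℂ (s + 1) (polyFibredGraph g A F ∩ torusLocus ℂ (s + 1)) ∧
    zariskiDim ℂ (polyFibredGraph g A F) = (s + 1 : ℕ) ∧
    addProjDim ℂ (s + 1) (polyFibredGraph g A F) = (s : ℕ) ∧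
    HasIntegerPeriod ℂ (projAdd '' (polyFibredGraph g A F ∩ torusLocus ℂ (s + 1))) := by
  obtain ⟨h1, h2, h3, h4, h5, h6, h7⟩ := ecCell_hypotheses_polyFibredGraph_of_injective g A F hτ hg
  refine ⟨h1, h2, h3, h4, h5, h6, h7, ?_⟩
  rw [hasIntegerPeriod_projAdd_polyFibredGraph_iff_of_injective g A F hτ]
  exact hper

/-- `ECCell (s+1) s` ⇒ `W(g; A, F)` meets `Γ_exp` (`τ` injective, `deg g ≥ 2`). [folklore] -/
theorem polyFibredGraph_inter_expGraph_nonempty_of_ecCell' (hτ : MulSubstInjective A F)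
    (hg : 2 ≤ g.totalDegree) (h : ECCell (s + 1) s) :
    (polyFibredGraph g A F ∩ expGraph ℂ (s + 1)).Nonempty := by
  obtain ⟨h1, h2, h3, h4, h5, h6, h7⟩ := ecCell_hypotheses_polyFibredGraph_of_injective g A F hτ hg
  exact h _ h1 h2 h3 h4 h5 h6 h7

/-- `ECCellAperiodic s` ⇒ `W(g; A, F)` meets `Γ_exp` (`τ` injective, `s ≥ 1`, aperiodic base).
[folklore] -/
theorem polyFibredGraph_inter_expGraph_nonempty_of_ecCellAperiodic (hτ : MulSubstInjective A F)
    (hs : 0 < s) (haper : ¬ HasIntegerPeriod ℂ (graphBase g)) (h : ECCellAperiodic s) :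
    (polyFibredGraph g A F ∩ expGraph ℂ (s + 1)).Nonempty := by
  obtain ⟨h1, h2, h3, h4, h5, h6, h7⟩ :=
    ecCellAperiodic_hypotheses_polyFibredGraph_of_injective g A F hτ hs haper
  exact h _ h1 h2 h3 h4 h5 h6 h7

/-- `ECCellPeriodic s` ⇒ `W(g; A, F)` meets `Γ_exp` (`τ` injective, `deg g ≥ 2`, periodic base).
[folklore] -/
theorem polyFibredGraph_inter_expGraph_nonempty_of_ecCellPeriodic (hτ : MulSubstInjective A F)
    (hg : 2 ≤ g.totalDegree) (hper : HasIntegerPeriod ℂ (graphBase g)) (h : ECCellPeriodic s) :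
    (polyFibredGraph g A F ∩ expGraph ℂ (s + 1)).Nonempty := by
  obtain ⟨h1, h2, h3, h4, h5, h6, h7, h8⟩ :=
    ecCellPeriodic_hypotheses_polyFibredGraph_of_injective g A F hτ hg hper
  exact h _ h1 h2 h3 h4 h5 h6 h7 h8

end InjectiveSubst

/-! ### Injectivity of `τ` from ONE dominant slice `x' ↦ (Aⱼ + u₀ Fⱼ(u₀, x'))ⱼ` -/

section FibreAt

variable {s : ℕ} (A : Fin s → MvPolynomial (Fin s) ℂ) (F : Fin s → MvPolynomial (Fin (s + 1)) ℂ)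

/-- `π_{u₀} : ℂ[y₁, …, yₛ, U] → ℂ[X₁, …, Xₛ]`, `U ↦ u₀`, `yⱼ ↦ Xⱼ` (`killLast` is `π₀`).
[folklore] -/
def killAt (u₀ : ℂ) : MvPolynomial (Fin (s + 1)) ℂ →ₐ[ℂ] MvPolynomial (Fin s) ℂ :=
  aeval (Fin.snoc X (C u₀) : Fin (s + 1) → MvPolynomial (Fin s) ℂ)

/-- `π_{u₀} U = u₀`. [folklore] -/
@[simp] theorem killAt_X_last (u₀ : ℂ) :
    killAt u₀ (X (Fin.last s) : MvPolynomial (Fin (s + 1)) ℂ) = C u₀ := by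
  simp [killAt]

/-- `π_{u₀} yⱼ = Xⱼ`. [folklore] -/
@[simp] theorem killAt_X_castSucc (u₀ : ℂ) (j : Fin s) :
    killAt u₀ (X (Fin.castSucc j) : MvPolynomial (Fin (s + 1)) ℂ) = X j := by
  simp [killAt]

/-- `π_{u₀} (p(y)) = p(X)`. [folklore] -/
theorem killAt_rename_castSucc (u₀ : ℂ) (p : MvPolynomial (Fin s) ℂ) :
    killAt u₀ (rename Fin.castSucc p) = p := by
  rw [killAt, aeval_rename, snoc_comp_castSucc, aeval_X_left_apply]

/-- `π_{u₀}` of a re-indexed fibre polynomial is the slice `q(u₀, X')`. [folklore] -/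
theorem killAt_rename_fibreIdx (u₀ : ℂ) (q : MvPolynomial (Fin (s + 1)) ℂ) :
    killAt u₀ (rename fibreIdx q) =
      aeval (Fin.cons (C u₀) X : Fin (s + 1) → MvPolynomial (Fin s) ℂ) q := by
  rw [killAt, aeval_rename, snoc_comp_fibreIdx]

/-- `π₀ = killLast`. [folklore] -/
theorem killAt_zero : (killAt 0 : MvPolynomial (Fin (s + 1)) ℂ →ₐ[ℂ] MvPolynomial (Fin s) ℂ) =
    killLast := by
  rw [killAt, killLast, C_0]

/-- `p|_{U = u₀}` read back in `ℂ[y, U]`. [folklore] -/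
theorem aeval_update_C_eq_rename_killAt (u₀ : ℂ) (p : MvPolynomial (Fin (s + 1)) ℂ) :
    aeval (Function.update X (Fin.last s) (C u₀ : MvPolynomial (Fin (s + 1)) ℂ)) p =
      rename Fin.castSucc (killAt u₀ p) := by
  induction p using MvPolynomial.induction_on with
  | C c => simp [killAt]
  | add p q hp hq => simp only [map_add, hp, hq]
  | mul_X p i hp =>
    simp only [map_mul, hp, aeval_X]
    congr 1
    induction i using Fin.lastCases with
    | last => rw [Function.update_self, killAt_X_last, rename_C]
    | cast j =>
      rw [Function.update_of_ne (Fin.castSucc_lt_last j).ne, killAt_X_castSucc, rename_X]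

/-- `Xᵢ - a` divides `p - p|_{Xᵢ = a}`. [folklore] -/
theorem X_sub_C_dvd_sub_aeval_update {σ : Type*} [DecidableEq σ] (i : σ) (a : ℂ)
    (p : MvPolynomial σ ℂ) :
    (X i - C a : MvPolynomial σ ℂ) ∣ p - aeval (Function.update X i (C a : MvPolynomial σ ℂ)) p := by
  induction p using MvPolynomial.induction_on with
  | C c =>
    rw [aeval_C, algebraMap_eq, sub_self]
    exact dvd_zero _
  | add p q hp hq =>
    have : p + q - aeval (Function.update X i (C a : MvPolynomial σ ℂ)) (p + q) =
        (p - aeval (Function.update X i (C a : MvPolynomial σ ℂ)) p) +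
          (q - aeval (Function.update X i (C a : MvPolynomial σ ℂ)) q) := by
      rw [map_add]
      ring
    rw [this]
    exact dvd_add hp hq
  | mul_X p j hp =>
    rw [map_mul, aeval_X]
    by_cases hji : j = i
    · subst hji
      rw [Function.update_self]
      have : p * X j - aeval (Function.update X j (C a : MvPolynomial σ ℂ)) p * C a =
          (p - aeval (Function.update X j (C a : MvPolynomial σ ℂ)) p) * X j +
            aeval (Function.update X j (C a : MvPolynomial σ ℂ)) p * (X j - C a) := by
        ring
      rw [this]
      exact dvd_add (dvd_mul_of_dvd_left hp _) (dvd_mul_left _ _)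
    · rw [Function.update_of_ne hji]
      have : p * X j - aeval (Function.update X i (C a : MvPolynomial σ ℂ)) p * X j =
          (p - aeval (Function.update X i (C a : MvPolynomial σ ℂ)) p) * X j := by
        ring
      rw [this]
      exact dvd_mul_of_dvd_left hp _

/-- `Xᵢ - a` is not a unit (value `0` at `Xᵢ = a`). [folklore] -/
theorem not_isUnit_X_sub_C {σ : Type*} (i : σ) (a : ℂ) :
    ¬ IsUnit (X i - C a : MvPolynomial σ ℂ) := by
  intro h
  have := h.map (eval fun _ => a)
  rw [map_sub, eval_X, eval_C, sub_self] at this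
  exact not_isUnit_zero this

/-- **The fibre at height `u₀`**: the self-map `x' ↦ (Aⱼ(x') + u₀ Fⱼ(u₀, x'))ⱼ` of `ℂˢ`, i.e. the
multiplicative coordinates `y₁, …, yₛ` of `W(g; A, F)` on the slice `yₙ = u₀`. [folklore] -/
def fibreAt (u₀ : ℂ) : Fin s → MvPolynomial (Fin s) ℂ := fun j =>
  A j + C u₀ * aeval (Fin.cons (C u₀) X : Fin (s + 1) → MvPolynomial (Fin s) ℂ) (F j)

/-- At height `0` the fibre is the `u⁰`-part `A`. [folklore] -/
@[simp] theorem fibreAt_zero : fibreAt A F 0 = A := by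
  funext j
  simp [fibreAt]

/-- **`π_{u₀} ∘ τ = aeval (fibreAt u₀) ∘ π_{u₀}`**. [folklore] -/
theorem killAt_aeval_pMulSubst (u₀ : ℂ) (p : MvPolynomial (Fin (s + 1)) ℂ) :
    killAt u₀ (aeval (pMulSubst A F) p) = aeval (fibreAt A F u₀) (killAt u₀ p) := by
  induction p using MvPolynomial.induction_on with
  | C c => simp [killAt]
  | add p q hp hq => simp only [map_add, hp, hq]
  | mul_X p i hp =>
    simp only [map_mul, hp, aeval_X]
    congr 1
    induction i using Fin.lastCases with
    | last => rw [pMulSubst_last, killAt_X_last, aeval_C, algebraMap_eq]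
    | cast j =>
      rw [pMulSubst_castSucc, killAt_X_castSucc, aeval_X, map_add, map_mul, killAt_X_last,
        killAt_rename_castSucc, killAt_rename_fibreIdx]
      rfl

/-- **One dominant slice makes `τ` injective.** If `x' ↦ (Aⱼ(x') + u₀Fⱼ(u₀, x'))ⱼ` is a dominant
self-map of `ℂˢ` for some `u₀ ∈ ℂ`, then `τ : Yⱼ ↦ Ãⱼ + U F̃ⱼ, Yₙ ↦ U` is injective: if
`τ p = 0 ≠ p`, write `p = (U - u₀)ᵏ p'` with `(U - u₀) ∤ p'`; then `τ p' = 0`, so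
`aeval (fibreAt u₀) (π_{u₀} p') = π_{u₀}(τ p') = 0`, so `π_{u₀} p' = 0` by dominance, i.e.
`p'|_{U = u₀} = 0` and `(U - u₀) ∣ p'` — contradiction. (`u₀ = 0` is
`EACRotundityProofs.aeval_pMulSubst_injective`.) [folklore] -/
theorem mulSubstInjective_of_fibreAt (u₀ : ℂ)
    (h : Function.Injective (aeval (fibreAt A F u₀) :
      MvPolynomial (Fin s) ℂ →ₐ[ℂ] MvPolynomial (Fin s) ℂ)) :
    MulSubstInjective A F := by
  classical
  unfold MulSubstInjective
  rw [injective_iff_map_eq_zero]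
  intro p hp
  by_contra hp0
  obtain ⟨k, p', hndvd, rfl⟩ :=
    WfDvdMonoid.max_power_factor' hp0 (not_isUnit_X_sub_C (Fin.last s) u₀)
  rw [map_mul, map_pow, map_sub, aeval_X, aeval_C, algebraMap_eq, pMulSubst_last] at hp
  have hp' : aeval (pMulSubst A F) p' = 0 :=
    (mul_eq_zero.1 hp).resolve_left (pow_ne_zero _ (X_sub_C_ne_zero _ _))
  have hkill : killAt u₀ p' = 0 := by
    apply h
    rw [map_zero, ← killAt_aeval_pMulSubst, hp', map_zero]
  have hzero : aeval (Function.update X (Fin.last s) (C u₀ : MvPolynomial (Fin (s + 1)) ℂ)) p' = 0 := by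
    rw [aeval_update_C_eq_rename_killAt, hkill, map_zero]
  have hdvd := X_sub_C_dvd_sub_aeval_update (Fin.last s) u₀ p'
  rw [hzero, sub_zero] at hdvd
  exact hndvd hdvd

/-- **Translations do not affect dominance**: `x' ↦ (kⱼ + Qⱼ(x'))ⱼ` is dominant iff
`x' ↦ (Qⱼ(x'))ⱼ` is. [folklore] -/
theorem aeval_C_add_injective_iff (k : Fin s → ℂ) (Q : Fin s → MvPolynomial (Fin s) ℂ) :
    Function.Injective (aeval (fun j => C (k j) + Q j) :
        MvPolynomial (Fin s) ℂ →ₐ[ℂ] MvPolynomial (Fin s) ℂ) ↔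
      Function.Injective (aeval Q : MvPolynomial (Fin s) ℂ →ₐ[ℂ] MvPolynomial (Fin s) ℂ) := by
  set sh : MvPolynomial (Fin s) ℂ →ₐ[ℂ] MvPolynomial (Fin s) ℂ := aeval fun j => C (k j) + X j
    with hsh
  set sh' : MvPolynomial (Fin s) ℂ →ₐ[ℂ] MvPolynomial (Fin s) ℂ := aeval fun j => X j - C (k j)
    with hsh'
  have h1 : (aeval fun j => C (k j) + Q j : MvPolynomial (Fin s) ℂ →ₐ[ℂ] MvPolynomial (Fin s) ℂ) =
      (aeval Q).comp sh := by
    refine MvPolynomial.algHom_ext fun j => ?_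
    simp only [hsh, aeval_X, AlgHom.coe_comp, Function.comp_apply, map_add, aeval_C, algebraMap_eq]
  have h2 : ∀ p, sh (sh' p) = p := fun p => by
    have : sh.comp sh' = AlgHom.id ℂ _ := by
      refine MvPolynomial.algHom_ext fun j => ?_
      simp only [hsh, hsh', AlgHom.coe_comp, Function.comp_apply, aeval_X, map_sub, aeval_C,
        algebraMap_eq, AlgHom.coe_id, id_eq]
      ring
    simpa using congrArg (fun f => f p) this
  have h3 : ∀ p, sh' (sh p) = p := fun p => by
    have : sh'.comp sh = AlgHom.id ℂ _ := by
      refine MvPolynomial.algHom_ext fun j => ?_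
      simp only [hsh, hsh', AlgHom.coe_comp, Function.comp_apply, aeval_X, map_add, aeval_C,
        algebraMap_eq, AlgHom.coe_id, id_eq]
      ring
    simpa using congrArg (fun f => f p) this
  have hbij : Function.Bijective sh :=
    ⟨Function.LeftInverse.injective h3, Function.RightInverse.surjective h2⟩
  rw [h1, AlgHom.coe_comp]
  exact Function.Injective.of_comp_iff' _ hbij

end FibreAt

/-! ### Graph-fibre varieties `W(g; P)` -/

section GraphFibre

variable {s : ℕ}

/-- **`W(g; P) ⊆ ℂⁿ × ℂⁿ`** (`n = s + 1`): `xₙ = g(x')` and `yⱼ = Pⱼ(yₙ, x')` for `j ≤ s`, where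
`Pⱼ ∈ ℂ[u, x']` (variable `0` is `u = yₙ`, variable `i + 1` is `xᵢ`). All escape / oscillatory
families of `Summits/Schanuel` over graph bases are of this form. [cite: MantovaMasser2023, §1 p. 5
(the model system of the open case)] -/
def graphFibreVariety (g : MvPolynomial (Fin s) ℂ) (P : Fin s → MvPolynomial (Fin (s + 1)) ℂ) :
    Set (Fin (s + 1) ⊕ Fin (s + 1) → ℂ) :=
  {z | z (Sum.inl (Fin.last s)) = eval (fun j => z (Sum.inl (Fin.castSucc j))) g ∧
    ∀ j : Fin s, z (Sum.inr (Fin.castSucc j)) =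
      eval (Fin.cons (z (Sum.inr (Fin.last s))) fun i => z (Sum.inl (Fin.castSucc i))) (P j)}

variable (g : MvPolynomial (Fin s) ℂ) (P : Fin s → MvPolynomial (Fin (s + 1)) ℂ)

/-- Membership in `W(g; P)`. [folklore] -/
theorem mem_graphFibreVariety_iff (z : Fin (s + 1) ⊕ Fin (s + 1) → ℂ) :
    z ∈ graphFibreVariety g P ↔
      z (Sum.inl (Fin.last s)) = eval (fun j => z (Sum.inl (Fin.castSucc j))) g ∧
        ∀ j : Fin s, z (Sum.inr (Fin.castSucc j)) =
          eval (Fin.cons (z (Sum.inr (Fin.last s))) fun i => z (Sum.inl (Fin.castSucc i))) (P j) :=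
  Iff.rfl

/-- The `u`-free part `Pⱼ(0, X')` of the fibre polynomials. [folklore] -/
def fibreConst : Fin s → MvPolynomial (Fin s) ℂ := fun j =>
  aeval (Fin.cons 0 X : Fin (s + 1) → MvPolynomial (Fin s) ℂ) (P j)

/-- **The slice at height `u₀`**: `Pⱼ(u₀, X') ∈ ℂ[X']`. [folklore] -/
def fibreSlice (u₀ : ℂ) : Fin s → MvPolynomial (Fin s) ℂ := fun j =>
  aeval (Fin.cons (C u₀) X : Fin (s + 1) → MvPolynomial (Fin s) ℂ) (P j)

/-- The slice at `0` is the `u`-free part. [folklore] -/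
theorem fibreSlice_zero : fibreSlice P 0 = fibreConst P := by
  funext j
  simp [fibreSlice, fibreConst]

/-- `(Fin.cons u x) ∘ succ = x`. [folklore] -/
theorem cons_comp_succ {α : Type*} (u : α) (x : Fin s → α) :
    (Fin.cons u x : Fin (s + 1) → α) ∘ Fin.succ = x := by
  funext j
  simp

/-- `q|_{u = 0}` read back in `ℂ[u, x']`. [folklore] -/
theorem aeval_update_zero_eq_rename_succ (q : MvPolynomial (Fin (s + 1)) ℂ) :
    aeval (Function.update X 0 (0 : MvPolynomial (Fin (s + 1)) ℂ)) q =
      rename Fin.succ (aeval (Fin.cons 0 X : Fin (s + 1) → MvPolynomial (Fin s) ℂ) q) := by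
  induction q using MvPolynomial.induction_on with
  | C c => simp
  | add p q hp hq => simp only [map_add, hp, hq]
  | mul_X p i hp =>
    simp only [map_mul, hp, aeval_X]
    congr 1
    refine Fin.cases ?_ (fun j => ?_) i
    · rw [Function.update_self, Fin.cons_zero, map_zero]
    · rw [Function.update_of_ne (Fin.succ_ne_zero j), Fin.cons_succ, rename_X]

/-- `q = q(0, x') + u · Q` for some `Q ∈ ℂ[u, x']`. [folklore] -/
theorem exists_eq_fibreConst_add_X_mul (q : MvPolynomial (Fin (s + 1)) ℂ) :
    ∃ Q : MvPolynomial (Fin (s + 1)) ℂ,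
      q = rename Fin.succ (aeval (Fin.cons 0 X : Fin (s + 1) → MvPolynomial (Fin s) ℂ) q) +
        X 0 * Q := by
  obtain ⟨Q, hQ⟩ := X_dvd_sub_aeval_update (0 : Fin (s + 1)) q
  refine ⟨Q, ?_⟩
  rw [← aeval_update_zero_eq_rename_succ, ← hQ]
  ring

/-- The quotient `Qⱼ = (Pⱼ - Pⱼ(0, x'))/u`. [folklore] -/
def fibreQuot : Fin s → MvPolynomial (Fin (s + 1)) ℂ := fun j =>
  Classical.choose (exists_eq_fibreConst_add_X_mul (P j))

/-- `Pⱼ = Pⱼ(0, x') + u · Qⱼ`. [folklore] -/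
theorem fibre_factor (j : Fin s) :
    P j = rename Fin.succ (fibreConst P j) + X 0 * fibreQuot P j :=
  Classical.choose_spec (exists_eq_fibreConst_add_X_mul (P j))

/-- `Pⱼ(u, x') = Pⱼ(0, x') + u · Qⱼ(u, x')`. [folklore] -/
theorem eval_cons_fibre (u : ℂ) (x : Fin s → ℂ) (j : Fin s) :
    eval (Fin.cons u x : Fin (s + 1) → ℂ) (P j) =
      eval x (fibreConst P j) + u * eval (Fin.cons u x : Fin (s + 1) → ℂ) (fibreQuot P j) := by
  conv_lhs => rw [fibre_factor P j]
  rw [map_add, map_mul, eval_X, Fin.cons_zero, eval_rename, cons_comp_succ]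

/-- **`W(g; P) = W(g; P(0,·), Q)`**: graph-fibre varieties are poly-fibred graphs
(`EACRotundityProofs.polyFibredGraph`). [folklore] -/
theorem graphFibreVariety_eq_polyFibredGraph :
    graphFibreVariety g P = polyFibredGraph g (fibreConst P) (fibreQuot P) := by
  ext z
  rw [mem_graphFibreVariety_iff, mem_polyFibredGraph_iff]
  refine and_congr_right fun _ => forall_congr' fun j => ?_
  rw [eval_cons_fibre]

/-- Conversely every poly-fibred graph `W(g; A, F)` is the graph-fibre variety of
`Pⱼ = Aⱼ(x') + u Fⱼ`. [folklore] -/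
theorem polyFibredGraph_eq_graphFibreVariety (A : Fin s → MvPolynomial (Fin s) ℂ)
    (F : Fin s → MvPolynomial (Fin (s + 1)) ℂ) :
    polyFibredGraph g A F = graphFibreVariety g (fun j => rename Fin.succ (A j) + X 0 * F j) := by
  ext z
  rw [mem_graphFibreVariety_iff, mem_polyFibredGraph_iff]
  refine and_congr_right fun _ => forall_congr' fun j => ?_
  rw [map_add, map_mul, eval_X, Fin.cons_zero, eval_rename, cons_comp_succ]

/-- The fibre at height `u₀` of the presentation `(P(0,·), Q)` is the slice `P(u₀, ·)`. [folklore] -/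
theorem fibreAt_fibreConst_fibreQuot (u₀ : ℂ) :
    fibreAt (fibreConst P) (fibreQuot P) u₀ = fibreSlice P u₀ := by
  funext j
  simp only [fibreAt, fibreSlice]
  conv_rhs => rw [fibre_factor P j]
  rw [map_add, map_mul, aeval_X, Fin.cons_zero, aeval_rename, cons_comp_succ, aeval_X_left_apply]

/-- **A dominant slice `x' ↦ P(u₀, x')` makes the multiplicative substitution of `W(g; P)`
injective.** [folklore] -/
theorem mulSubstInjective_of_fibreSlice (u₀ : ℂ)
    (hP : Function.Injective (aeval (fibreSlice P u₀) :
      MvPolynomial (Fin s) ℂ →ₐ[ℂ] MvPolynomial (Fin s) ℂ)) :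
    MulSubstInjective (fibreConst P) (fibreQuot P) :=
  mulSubstInjective_of_fibreAt _ _ u₀ (by rw [fibreAt_fibreConst_fibreQuot]; exact hP)

/-- **`W(g; P)` satisfies the seven hypotheses of `ECCell (s+1) s`** when some slice
`x' ↦ P(u₀, x')` is dominant and `deg g ≥ 2` (binders in order). [folklore] -/
theorem ecCell_hypotheses_graphFibreVariety (u₀ : ℂ)
    (hP : Function.Injective (aeval (fibreSlice P u₀) :
      MvPolynomial (Fin s) ℂ →ₐ[ℂ] MvPolynomial (Fin s) ℂ))
    (hg : 2 ≤ g.totalDegree) :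
    IsIrreducibleClosed ℂ (graphFibreVariety g P) ∧
    (graphFibreVariety g P ∩ torusLocus ℂ (s + 1)).Nonempty ∧
    IsRotund ℂ (s + 1) (graphFibreVariety g P ∩ torusLocus ℂ (s + 1)) ∧
    IsAddFree ℂ (s + 1) (graphFibreVariety g P ∩ torusLocus ℂ (s + 1)) ∧
    IsMulFree ℂ (s + 1) (graphFibreVariety g P ∩ torusLocus ℂ (s + 1)) ∧
    zariskiDim ℂ (graphFibreVariety g P) = (s + 1 : ℕ) ∧
    addProjDim ℂ (s + 1) (graphFibreVariety g P) = (s : ℕ) := by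
  rw [graphFibreVariety_eq_polyFibredGraph]
  exact ecCell_hypotheses_polyFibredGraph_of_injective g _ _
    (mulSubstInjective_of_fibreSlice P u₀ hP) hg

/-- **Dominant slice, `s ≥ 1`, aperiodic base ⇒ `W(g; P)` is a member of `ECCellAperiodic s`**
(seven binders in order). [folklore] -/
theorem ecCellAperiodic_hypotheses_graphFibreVariety (u₀ : ℂ)
    (hP : Function.Injective (aeval (fibreSlice P u₀) :
      MvPolynomial (Fin s) ℂ →ₐ[ℂ] MvPolynomial (Fin s) ℂ))
    (hs : 0 < s) (haper : ¬ HasIntegerPeriod ℂ (graphBase g)) :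
    IsIrreducibleClosed ℂ (graphFibreVariety g P) ∧
    (graphFibreVariety g P ∩ torusLocus ℂ (s + 1)).Nonempty ∧
    IsAddFree ℂ (s + 1) (graphFibreVariety g P ∩ torusLocus ℂ (s + 1)) ∧
    IsMulFree ℂ (s + 1) (graphFibreVariety g P ∩ torusLocus ℂ (s + 1)) ∧
    zariskiDim ℂ (graphFibreVariety g P) = (s + 1 : ℕ) ∧
    addProjDim ℂ (s + 1) (graphFibreVariety g P) = (s : ℕ) ∧
    ¬ HasIntegerPeriod ℂ (projAdd '' (graphFibreVariety g P ∩ torusLocus ℂ (s + 1))) := by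
  rw [graphFibreVariety_eq_polyFibredGraph]
  exact ecCellAperiodic_hypotheses_polyFibredGraph_of_injective g _ _
    (mulSubstInjective_of_fibreSlice P u₀ hP) hs haper

/-- **Dominant slice, `deg g ≥ 2`, periodic base ⇒ `W(g; P)` is a member of `ECCellPeriodic s`**
(eight binders in order). [folklore] -/
theorem ecCellPeriodic_hypotheses_graphFibreVariety (u₀ : ℂ)
    (hP : Function.Injective (aeval (fibreSlice P u₀) :
      MvPolynomial (Fin s) ℂ →ₐ[ℂ] MvPolynomial (Fin s) ℂ))
    (hg : 2 ≤ g.totalDegree) (hper : HasIntegerPeriod ℂ (graphBase g)) :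
    IsIrreducibleClosed ℂ (graphFibreVariety g P) ∧
    (graphFibreVariety g P ∩ torusLocus ℂ (s + 1)).Nonempty ∧
    IsRotund ℂ (s + 1) (graphFibreVariety g P ∩ torusLocus ℂ (s + 1)) ∧
    IsAddFree ℂ (s + 1) (graphFibreVariety g P ∩ torusLocus ℂ (s + 1)) ∧
    IsMulFree ℂ (s + 1) (graphFibreVariety g P ∩ torusLocus ℂ (s + 1)) ∧
    zariskiDim ℂ (graphFibreVariety g P) = (s + 1 : ℕ) ∧
    addProjDim ℂ (s + 1) (graphFibreVariety g P) = (s : ℕ) ∧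
    HasIntegerPeriod ℂ (projAdd '' (graphFibreVariety g P ∩ torusLocus ℂ (s + 1))) := by
  rw [graphFibreVariety_eq_polyFibredGraph]
  exact ecCellPeriodic_hypotheses_polyFibredGraph_of_injective g _ _
    (mulSubstInjective_of_fibreSlice P u₀ hP) hg hper

/-- `ECCell (s+1) s` ⇒ `W(g; P)` meets `Γ_exp` (dominant slice, `deg g ≥ 2`). [folklore] -/
theorem graphFibreVariety_inter_expGraph_nonempty_of_ecCell (u₀ : ℂ)
    (hP : Function.Injective (aeval (fibreSlice P u₀) :
      MvPolynomial (Fin s) ℂ →ₐ[ℂ] MvPolynomial (Fin s) ℂ))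
    (hg : 2 ≤ g.totalDegree) (h : ECCell (s + 1) s) :
    (graphFibreVariety g P ∩ expGraph ℂ (s + 1)).Nonempty := by
  obtain ⟨h1, h2, h3, h4, h5, h6, h7⟩ := ecCell_hypotheses_graphFibreVariety g P u₀ hP hg
  exact h _ h1 h2 h3 h4 h5 h6 h7

/-- `ECCellAperiodic s` ⇒ `W(g; P)` meets `Γ_exp` (dominant slice, `s ≥ 1`, aperiodic base).
[folklore] -/
theorem graphFibreVariety_inter_expGraph_nonempty_of_ecCellAperiodic (u₀ : ℂ)
    (hP : Function.Injective (aeval (fibreSlice P u₀) :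
      MvPolynomial (Fin s) ℂ →ₐ[ℂ] MvPolynomial (Fin s) ℂ))
    (hs : 0 < s) (haper : ¬ HasIntegerPeriod ℂ (graphBase g)) (h : ECCellAperiodic s) :
    (graphFibreVariety g P ∩ expGraph ℂ (s + 1)).Nonempty := by
  obtain ⟨h1, h2, h3, h4, h5, h6, h7⟩ :=
    ecCellAperiodic_hypotheses_graphFibreVariety g P u₀ hP hs haper
  exact h _ h1 h2 h3 h4 h5 h6 h7

/-- `ECCellPeriodic s` ⇒ `W(g; P)` meets `Γ_exp` (dominant slice, `deg g ≥ 2`, periodic base).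
[folklore] -/
theorem graphFibreVariety_inter_expGraph_nonempty_of_ecCellPeriodic (u₀ : ℂ)
    (hP : Function.Injective (aeval (fibreSlice P u₀) :
      MvPolynomial (Fin s) ℂ →ₐ[ℂ] MvPolynomial (Fin s) ℂ))
    (hg : 2 ≤ g.totalDegree) (hper : HasIntegerPeriod ℂ (graphBase g)) (h : ECCellPeriodic s) :
    (graphFibreVariety g P ∩ expGraph ℂ (s + 1)).Nonempty := by
  obtain ⟨h1, h2, h3, h4, h5, h6, h7, h8⟩ :=
    ecCellPeriodic_hypotheses_graphFibreVariety g P u₀ hP hg hper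
  exact h _ h1 h2 h3 h4 h5 h6 h7 h8

/-- **Exponential points of `W(g; P)` ↔ solutions of `exp xⱼ = Pⱼ(e^{g(x)}, x)`** — the
conclusion shape of the problem-side escape theorems. [folklore] -/
theorem graphFibreVariety_inter_expGraph_nonempty_iff :
    (graphFibreVariety g P ∩ expGraph ℂ (s + 1)).Nonempty ↔
      ∃ x : Fin s → ℂ, ∀ j, Complex.exp (x j) =
        eval (Fin.cons (Complex.exp (eval x g)) x : Fin (s + 1) → ℂ) (P j) := by
  rw [graphFibreVariety_eq_polyFibredGraph, polyFibredGraph_inter_expGraph_nonempty_iff]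
  refine exists_congr fun x => forall_congr' fun j => ?_
  rw [eval_cons_fibre P (Complex.exp (eval x g)) x j]

end GraphFibre

/-! ### Degree of a quadric -/

section Degree

variable {s : ℕ}

/-- A nonzero exponent vector of degree `≤ 1` is a unit vector. [folklore] -/
theorem exists_eq_single_one_of_degree_le_one {σ : Type*} (d : σ →₀ ℕ)
    (hd : (d.sum fun _ e => e) ≤ 1) (h0 : d ≠ 0) : ∃ k, d = Finsupp.single k 1 := by
  classical
  obtain ⟨k, hk⟩ : ∃ k, d k ≠ 0 := by
    by_contra h
    push Not at h
    exact h0 (Finsupp.ext h)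
  have hk_mem : k ∈ d.support := Finsupp.mem_support_iff.2 hk
  have hsum : (d.sum fun _ e => e) = ∑ a ∈ d.support, d a := rfl
  refine ⟨k, Finsupp.ext fun a => ?_⟩
  by_cases hak : a = k
  · subst hak
    rw [Finsupp.single_eq_same]
    have hle : d a ≤ ∑ x ∈ d.support, d x :=
      Finset.single_le_sum (f := fun x => d x) (fun _ _ => Nat.zero_le _) hk_mem
    omega
  · rw [Finsupp.single_apply, if_neg (Ne.symm hak)]
    by_contra ha
    have ha_mem : a ∈ d.support := Finsupp.mem_support_iff.2 ha
    have hsub : ({k, a} : Finset σ) ⊆ d.support := by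
      intro x hx
      rw [Finset.mem_insert, Finset.mem_singleton] at hx
      rcases hx with rfl | rfl
      · exact hk_mem
      · exact ha_mem
    have hle : ∑ x ∈ ({k, a} : Finset σ), d x ≤ ∑ x ∈ d.support, d x :=
      Finset.sum_le_sum_of_subset_of_nonneg hsub fun _ _ _ => Nat.zero_le _
    rw [Finset.sum_pair (Ne.symm hak)] at hle
    omega

/-- **A polynomial of total degree `≤ 1` is an affine function**: second differences vanish,
`p(x + w) + p(0) = p(x) + p(w)`. [folklore] -/
theorem eval_add_add_eval_zero_of_totalDegree_le_one {σ : Type*} (p : MvPolynomial σ ℂ)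
    (hp : p.totalDegree ≤ 1) (x w : σ → ℂ) :
    eval (x + w) p + eval 0 p = eval x p + eval w p := by
  classical
  have key : ∀ d ∈ p.support, ∀ a : ℂ,
      eval (x + w) (monomial d a) + eval 0 (monomial d a) =
        eval x (monomial d a) + eval w (monomial d a) := by
    intro d hd a
    by_cases hd0 : d = 0
    · subst hd0
      simp
    · obtain ⟨k, rfl⟩ :=
        exists_eq_single_one_of_degree_le_one d ((le_totalDegree hd).trans hp) hd0
      simp only [eval_monomial, Finsupp.prod_single_index, pow_zero, pow_one, Pi.add_apply,
        Pi.zero_apply]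
      ring
  calc eval (x + w) p + eval 0 p
      = ∑ d ∈ p.support, (eval (x + w) (monomial d (coeff d p)) +
          eval 0 (monomial d (coeff d p))) := by
        conv_lhs => rw [p.as_sum]
        rw [map_sum, map_sum, ← Finset.sum_add_distrib]
    _ = ∑ d ∈ p.support, (eval x (monomial d (coeff d p)) + eval w (monomial d (coeff d p))) :=
        Finset.sum_congr rfl fun d hd => key d hd _
    _ = eval x p + eval w p := by
        conv_rhs => rw [p.as_sum]
        rw [map_sum, map_sum, ← Finset.sum_add_distrib]

/-- **A quadric with `M + Mᵀ ≠ 0` has total degree `≥ 2`**: the second difference of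
`Σ Mₖₗxₖxₗ + Σ bₖxₖ + c` at `(eᵢ, eⱼ)` is `Mᵢⱼ + Mⱼᵢ`. [folklore] -/
theorem two_le_totalDegree_quadPoly (M : Fin s → Fin s → ℂ) (b : Fin s → ℂ) (c : ℂ)
    {i j : Fin s} (hM : M i j + M j i ≠ 0) : 2 ≤ (quadPoly M b c).totalDegree := by
  classical
  by_contra hlt
  have h1 : (quadPoly M b c).totalDegree ≤ 1 := by omega
  have h2 := eval_add_add_eval_zero_of_totalDegree_le_one _ h1 (Pi.single i 1) (Pi.single j 1)
  simp only [eval_quadPoly] at h2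
  rw [quadFun_add] at h2
  have hcross : ∑ k, (Pi.single i (1 : ℂ) : Fin s → ℂ) k *
      (∑ l, (M k l + M l k) * (Pi.single j (1 : ℂ) : Fin s → ℂ) l) = M i j + M j i := by
    rw [sum_single_one_mul]
    simp only [Pi.single_apply, mul_ite, mul_one, mul_zero, Finset.sum_ite_eq',
      Finset.mem_univ, if_true]
  rw [hcross] at h2
  simp only [quadFun, Pi.zero_apply, mul_zero, Finset.sum_const_zero, zero_add] at h2
  exact hM (by linear_combination h2)

/-- `κᵀMκ ≠ 0` forces `M + Mᵀ ≠ 0` (`κᵀ(M + Mᵀ)κ = 2κᵀMκ`). [folklore] -/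
theorem exists_add_ne_zero_of_quadForm_ne_zero (M : Fin s → Fin s → ℂ) (κ : Fin s → ℂ)
    (hα : ∑ i, ∑ j, M i j * κ i * κ j ≠ 0) : ∃ i j, M i j + M j i ≠ 0 := by
  by_contra h
  push Not at h
  have h2 := sum_mul_symm_apply_eq_two_mul (F := ℂ) M κ
  simp only [h, zero_mul, mul_zero, Finset.sum_const_zero] at h2
  exact hα ((mul_eq_zero.1 h2.symm).resolve_left two_ne_zero)

end Degree

/-! ### Monomial ("power") fibres over a quadric graph -/

section PowerFibres

variable {s : ℕ} (M : Fin s → Fin s → ℂ) (b : Fin s → ℂ) (c₀ : ℂ) (κ : Fin s → ℕ) (c : Fin s → ℂ)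
  (A : Fin s → MvPolynomial (Fin s) ℂ)

/-- **The monomial-fibre escape variety of the problem side**
`{xₙ = Σ Mᵢₗxᵢxₗ + Σ bᵢxᵢ + c₀, yⱼ = cⱼ yₙ^{κⱼ} + Aⱼ(x') (j ≤ s)} ⊆ ℂⁿ × ℂⁿ` — LITERALLY the set of
`Summit.Schanuel.Schanuel.Theorems.quadricEscapePowers_inter_expGraph_nonempty` (`κ ≡ 1`: the set of
`quadricEscapeMatrix_inter_expGraph_nonempty`). [cite: MantovaMasser2023, §1 p. 5 (the open case
dim π(V) = 2 in ℂ³ × (ℂˣ)³)] -/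
def powerFibreVariety : Set (Fin (s + 1) ⊕ Fin (s + 1) → ℂ) :=
  {z | z (Sum.inl (Fin.last s)) =
      ∑ i, ∑ l, M i l * z (Sum.inl (Fin.castSucc i)) * z (Sum.inl (Fin.castSucc l)) +
        ∑ i, b i * z (Sum.inl (Fin.castSucc i)) + c₀ ∧
    ∀ j : Fin s, z (Sum.inr (Fin.castSucc j)) =
      c j * z (Sum.inr (Fin.last s)) ^ (κ j) + eval (fun i => z (Sum.inl (Fin.castSucc i))) (A j)}

/-- The fibre polynomials `cⱼ u^{κⱼ} + Aⱼ(x') ∈ ℂ[u, x']`. [folklore] -/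
def powerFibrePoly : Fin s → MvPolynomial (Fin (s + 1)) ℂ := fun j =>
  C (c j) * X 0 ^ (κ j) + rename Fin.succ (A j)

/-- `powerFibreVariety = W(quadPoly M b c₀; powerFibrePoly)`. [folklore] -/
theorem powerFibreVariety_eq_graphFibreVariety :
    powerFibreVariety M b c₀ κ c A = graphFibreVariety (quadPoly M b c₀) (powerFibrePoly κ c A) := by
  ext z
  simp only [powerFibreVariety, mem_graphFibreVariety_iff, eval_quadPoly, quadFun, powerFibrePoly,
    map_add, map_mul, map_pow, eval_C, eval_X, Fin.cons_zero, eval_rename, cons_comp_succ,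
    Set.mem_setOf_eq]

/-- The slice at height `u₀` is `x' ↦ (cⱼu₀^{κⱼ} + Aⱼ(x'))ⱼ`. [folklore] -/
theorem fibreSlice_powerFibrePoly (u₀ : ℂ) :
    fibreSlice (powerFibrePoly κ c A) u₀ = fun j => C (c j * u₀ ^ (κ j)) + A j := by
  funext j
  simp only [fibreSlice, powerFibrePoly, map_add, map_mul, map_pow, aeval_C, algebraMap_eq, aeval_X,
    Fin.cons_zero, aeval_rename, cons_comp_succ, aeval_X_left_apply]

/-- Dominant `A` ⇒ every slice of the monomial fibres is dominant. [folklore] -/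
theorem fibreSlice_powerFibrePoly_injective (u₀ : ℂ)
    (hA : Function.Injective (aeval A : MvPolynomial (Fin s) ℂ →ₐ[ℂ] MvPolynomial (Fin s) ℂ)) :
    Function.Injective (aeval (fibreSlice (powerFibrePoly κ c A) u₀) :
      MvPolynomial (Fin s) ℂ →ₐ[ℂ] MvPolynomial (Fin s) ℂ) := by
  rw [fibreSlice_powerFibrePoly, aeval_C_add_injective_iff]
  exact hA

/-- **Dominant `A`, `M + Mᵀ ≠ 0` ⇒ the monomial-fibre variety satisfies the seven hypotheses of
`ECCell (s+1) s`** (any `κ`, any `c`; binders in order). [folklore] -/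
theorem ecCell_hypotheses_powerFibreVariety
    (hA : Function.Injective (aeval A : MvPolynomial (Fin s) ℂ →ₐ[ℂ] MvPolynomial (Fin s) ℂ))
    (hM : ∃ i j, M i j + M j i ≠ 0) :
    IsIrreducibleClosed ℂ (powerFibreVariety M b c₀ κ c A) ∧
    (powerFibreVariety M b c₀ κ c A ∩ torusLocus ℂ (s + 1)).Nonempty ∧
    IsRotund ℂ (s + 1) (powerFibreVariety M b c₀ κ c A ∩ torusLocus ℂ (s + 1)) ∧
    IsAddFree ℂ (s + 1) (powerFibreVariety M b c₀ κ c A ∩ torusLocus ℂ (s + 1)) ∧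
    IsMulFree ℂ (s + 1) (powerFibreVariety M b c₀ κ c A ∩ torusLocus ℂ (s + 1)) ∧
    zariskiDim ℂ (powerFibreVariety M b c₀ κ c A) = (s + 1 : ℕ) ∧
    addProjDim ℂ (s + 1) (powerFibreVariety M b c₀ κ c A) = (s : ℕ) := by
  obtain ⟨i, j, hij⟩ := hM
  rw [powerFibreVariety_eq_graphFibreVariety]
  exact ecCell_hypotheses_graphFibreVariety _ _ 0 (fibreSlice_powerFibrePoly_injective κ c A 0 hA)
    (two_le_totalDegree_quadPoly M b c₀ hij)

/-- **Dominant `A`, `s ≥ 1`, aperiodic quadric ⇒ member of `ECCellAperiodic s`** (seven binders in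
order; the period test is `EACQuadricBases.hasIntegerPeriod_graphBase_quadPoly_iff`: no
`w ∈ ℤ^{s+1} ∖ 0` with `(M + Mᵀ)w' = 0`, `b·w' = w_{s+1}`). [folklore] -/
theorem ecCellAperiodic_hypotheses_powerFibreVariety (hs : 0 < s)
    (hA : Function.Injective (aeval A : MvPolynomial (Fin s) ℂ →ₐ[ℂ] MvPolynomial (Fin s) ℂ))
    (haper : ¬ ∃ w : Fin (s + 1) → ℤ, w ≠ 0 ∧
      (∀ i, ∑ j, (M i j + M j i) * (w (Fin.castSucc j) : ℂ) = 0) ∧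
      ∑ i, b i * (w (Fin.castSucc i) : ℂ) = (w (Fin.last s) : ℂ)) :
    IsIrreducibleClosed ℂ (powerFibreVariety M b c₀ κ c A) ∧
    (powerFibreVariety M b c₀ κ c A ∩ torusLocus ℂ (s + 1)).Nonempty ∧
    IsAddFree ℂ (s + 1) (powerFibreVariety M b c₀ κ c A ∩ torusLocus ℂ (s + 1)) ∧
    IsMulFree ℂ (s + 1) (powerFibreVariety M b c₀ κ c A ∩ torusLocus ℂ (s + 1)) ∧
    zariskiDim ℂ (powerFibreVariety M b c₀ κ c A) = (s + 1 : ℕ) ∧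
    addProjDim ℂ (s + 1) (powerFibreVariety M b c₀ κ c A) = (s : ℕ) ∧
    ¬ HasIntegerPeriod ℂ (projAdd '' (powerFibreVariety M b c₀ κ c A ∩ torusLocus ℂ (s + 1))) := by
  rw [← hasIntegerPeriod_graphBase_quadPoly_iff] at haper
  rw [powerFibreVariety_eq_graphFibreVariety]
  exact ecCellAperiodic_hypotheses_graphFibreVariety _ _ 0
    (fibreSlice_powerFibrePoly_injective κ c A 0 hA) hs haper

/-- **Dominant `A`, `M + Mᵀ ≠ 0`, periodic quadric ⇒ member of `ECCellPeriodic s`** (eight binders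
in order). [folklore] -/
theorem ecCellPeriodic_hypotheses_powerFibreVariety
    (hA : Function.Injective (aeval A : MvPolynomial (Fin s) ℂ →ₐ[ℂ] MvPolynomial (Fin s) ℂ))
    (hM : ∃ i j, M i j + M j i ≠ 0)
    (hper : ∃ w : Fin (s + 1) → ℤ, w ≠ 0 ∧
      (∀ i, ∑ j, (M i j + M j i) * (w (Fin.castSucc j) : ℂ) = 0) ∧
      ∑ i, b i * (w (Fin.castSucc i) : ℂ) = (w (Fin.last s) : ℂ)) :
    IsIrreducibleClosed ℂ (powerFibreVariety M b c₀ κ c A) ∧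
    (powerFibreVariety M b c₀ κ c A ∩ torusLocus ℂ (s + 1)).Nonempty ∧
    IsRotund ℂ (s + 1) (powerFibreVariety M b c₀ κ c A ∩ torusLocus ℂ (s + 1)) ∧
    IsAddFree ℂ (s + 1) (powerFibreVariety M b c₀ κ c A ∩ torusLocus ℂ (s + 1)) ∧
    IsMulFree ℂ (s + 1) (powerFibreVariety M b c₀ κ c A ∩ torusLocus ℂ (s + 1)) ∧
    zariskiDim ℂ (powerFibreVariety M b c₀ κ c A) = (s + 1 : ℕ) ∧
    addProjDim ℂ (s + 1) (powerFibreVariety M b c₀ κ c A) = (s : ℕ) ∧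
    HasIntegerPeriod ℂ (projAdd '' (powerFibreVariety M b c₀ κ c A ∩ torusLocus ℂ (s + 1))) := by
  obtain ⟨i, j, hij⟩ := hM
  rw [← hasIntegerPeriod_graphBase_quadPoly_iff] at hper
  rw [powerFibreVariety_eq_graphFibreVariety]
  exact ecCellPeriodic_hypotheses_graphFibreVariety _ _ 0
    (fibreSlice_powerFibrePoly_injective κ c A 0 hA) (two_le_totalDegree_quadPoly M b c₀ hij) hper

/-- `ECCell (s+1) s` ⇒ the monomial-fibre variety meets `Γ_exp` (dominant `A`, `M + Mᵀ ≠ 0`).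
[folklore] -/
theorem powerFibreVariety_inter_expGraph_nonempty_of_ecCell
    (hA : Function.Injective (aeval A : MvPolynomial (Fin s) ℂ →ₐ[ℂ] MvPolynomial (Fin s) ℂ))
    (hM : ∃ i j, M i j + M j i ≠ 0) (h : ECCell (s + 1) s) :
    (powerFibreVariety M b c₀ κ c A ∩ expGraph ℂ (s + 1)).Nonempty := by
  obtain ⟨h1, h2, h3, h4, h5, h6, h7⟩ := ecCell_hypotheses_powerFibreVariety M b c₀ κ c A hA hM
  exact h _ h1 h2 h3 h4 h5 h6 h7

/-- `ECCellAperiodic s` ⇒ the monomial-fibre variety meets `Γ_exp` (dominant `A`, `s ≥ 1`,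
aperiodic quadric). [folklore] -/
theorem powerFibreVariety_inter_expGraph_nonempty_of_ecCellAperiodic (hs : 0 < s)
    (hA : Function.Injective (aeval A : MvPolynomial (Fin s) ℂ →ₐ[ℂ] MvPolynomial (Fin s) ℂ))
    (haper : ¬ ∃ w : Fin (s + 1) → ℤ, w ≠ 0 ∧
      (∀ i, ∑ j, (M i j + M j i) * (w (Fin.castSucc j) : ℂ) = 0) ∧
      ∑ i, b i * (w (Fin.castSucc i) : ℂ) = (w (Fin.last s) : ℂ))
    (h : ECCellAperiodic s) :
    (powerFibreVariety M b c₀ κ c A ∩ expGraph ℂ (s + 1)).Nonempty := by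
  obtain ⟨h1, h2, h3, h4, h5, h6, h7⟩ :=
    ecCellAperiodic_hypotheses_powerFibreVariety M b c₀ κ c A hs hA haper
  exact h _ h1 h2 h3 h4 h5 h6 h7

/-- `ECCellPeriodic s` ⇒ the monomial-fibre variety meets `Γ_exp` (dominant `A`, `M + Mᵀ ≠ 0`,
periodic quadric). [folklore] -/
theorem powerFibreVariety_inter_expGraph_nonempty_of_ecCellPeriodic
    (hA : Function.Injective (aeval A : MvPolynomial (Fin s) ℂ →ₐ[ℂ] MvPolynomial (Fin s) ℂ))
    (hM : ∃ i j, M i j + M j i ≠ 0)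
    (hper : ∃ w : Fin (s + 1) → ℤ, w ≠ 0 ∧
      (∀ i, ∑ j, (M i j + M j i) * (w (Fin.castSucc j) : ℂ) = 0) ∧
      ∑ i, b i * (w (Fin.castSucc i) : ℂ) = (w (Fin.last s) : ℂ))
    (h : ECCellPeriodic s) :
    (powerFibreVariety M b c₀ κ c A ∩ expGraph ℂ (s + 1)).Nonempty := by
  obtain ⟨h1, h2, h3, h4, h5, h6, h7, h8⟩ :=
    ecCellPeriodic_hypotheses_powerFibreVariety M b c₀ κ c A hA hM hper
  exact h _ h1 h2 h3 h4 h5 h6 h7 h8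

/-- **Exponential points of the monomial-fibre variety ↔ solutions of the problem-side system**
`exp xⱼ = cⱼ (e^{g(x)})^{κⱼ} + Aⱼ(x)` — EXACTLY the conclusion of
`Summit.….exists_expPoint_quadricEscape_powers`. [folklore] -/
theorem powerFibreVariety_inter_expGraph_nonempty_iff :
    (powerFibreVariety M b c₀ κ c A ∩ expGraph ℂ (s + 1)).Nonempty ↔
      ∃ x : Fin s → ℂ, ∀ j, Complex.exp (x j) =
        c j * Complex.exp (∑ i, ∑ l, M i l * x i * x l + ∑ i, b i * x i + c₀) ^ (κ j) +
          eval x (A j) := by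
  rw [powerFibreVariety_eq_graphFibreVariety, graphFibreVariety_inter_expGraph_nonempty_iff]
  refine exists_congr fun x => forall_congr' fun j => ?_
  simp only [eval_quadPoly, quadFun, powerFibrePoly, map_add, map_mul, map_pow, eval_C, eval_X,
    Fin.cons_zero, eval_rename, cons_comp_succ]

end PowerFibres

/-! ### Laurent fibres with constant top coefficient over a quadric graph -/

section LaurentFibres

variable {s K : ℕ} (M : Fin s → Fin s → ℂ) (b : Fin s → ℂ) (c₀ : ℂ) (κ : Fin s → ℕ)
  (c : Fin s → ℂ) (A : Fin s → Fin K → MvPolynomial (Fin s) ℂ)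

/-- **The constant-top-coefficient ("Laurent") fibre variety, polynomial form**:
`{xₙ = Σ Mᵢₗxᵢxₗ + Σ bᵢxᵢ + c₀, yⱼ = cⱼ yₙ^{κⱼ} + Σ_{i<K} A_{j,i}(x') yₙ^{κⱼ-(i+1)} (j ≤ s)}` — for
`K ≤ κⱼ` the Zariski-closed graph variety whose torus points are those of the set of
`Summit.Schanuel.Schanuel.Theorems.quadricEscapeLaurent_inter_expGraph_nonempty` (written there with
inverse powers `yₙ^{κⱼ}(cⱼ + Σ A_{j,i} yₙ^{-(i+1)})`; `laurentFibreVariety_inter_torusLocus_eq`).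
[cite: MantovaMasser2023, §1 p. 5 (the open case dim π(V) = 2 in ℂ³ × (ℂˣ)³)] -/
def laurentFibreVariety : Set (Fin (s + 1) ⊕ Fin (s + 1) → ℂ) :=
  {z | z (Sum.inl (Fin.last s)) =
      ∑ i, ∑ l, M i l * z (Sum.inl (Fin.castSucc i)) * z (Sum.inl (Fin.castSucc l)) +
        ∑ i, b i * z (Sum.inl (Fin.castSucc i)) + c₀ ∧
    ∀ j : Fin s, z (Sum.inr (Fin.castSucc j)) =
      c j * z (Sum.inr (Fin.last s)) ^ (κ j) +
        ∑ i : Fin K, eval (fun l => z (Sum.inl (Fin.castSucc l))) (A j i) *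
          z (Sum.inr (Fin.last s)) ^ (κ j - ((i : ℕ) + 1))}

/-- The fibre polynomials `cⱼ u^{κⱼ} + Σᵢ A_{j,i}(x') u^{κⱼ-(i+1)} ∈ ℂ[u, x']`. [folklore] -/
def laurentFibrePoly : Fin s → MvPolynomial (Fin (s + 1)) ℂ := fun j =>
  C (c j) * X 0 ^ (κ j) + ∑ i : Fin K, rename Fin.succ (A j i) * X 0 ^ (κ j - ((i : ℕ) + 1))

/-- The slice of the non-constant part at height `u₀`: `x' ↦ (Σᵢ u₀^{κⱼ-(i+1)} A_{j,i}(x'))ⱼ`.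
[folklore] -/
def laurentSlice (u₀ : ℂ) : Fin s → MvPolynomial (Fin s) ℂ := fun j =>
  ∑ i : Fin K, C (u₀ ^ (κ j - ((i : ℕ) + 1))) * A j i

/-- `laurentFibreVariety = W(quadPoly M b c₀; laurentFibrePoly)`. [folklore] -/
theorem laurentFibreVariety_eq_graphFibreVariety :
    laurentFibreVariety M b c₀ κ c A =
      graphFibreVariety (quadPoly M b c₀) (laurentFibrePoly κ c A) := by
  ext z
  simp only [laurentFibreVariety, mem_graphFibreVariety_iff, eval_quadPoly, quadFun,
    laurentFibrePoly, map_add, map_sum, map_mul, map_pow, eval_C, eval_X, Fin.cons_zero,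
    eval_rename, cons_comp_succ, Set.mem_setOf_eq]

/-- The slice at height `u₀` is `cⱼu₀^{κⱼ} + laurentSlice u₀`. [folklore] -/
theorem fibreSlice_laurentFibrePoly (u₀ : ℂ) :
    fibreSlice (laurentFibrePoly κ c A) u₀ = fun j => C (c j * u₀ ^ (κ j)) + laurentSlice κ A u₀ j := by
  funext j
  simp only [fibreSlice, laurentFibrePoly, laurentSlice, map_add, map_sum, map_mul, map_pow, aeval_C,
    algebraMap_eq, aeval_X, Fin.cons_zero, aeval_rename, cons_comp_succ, aeval_X_left_apply]
  congr 1
  exact Finset.sum_congr rfl fun i _ => mul_comm _ _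

/-- A dominant `laurentSlice u₀` ⇒ the slice at height `u₀` is dominant. [folklore] -/
theorem fibreSlice_laurentFibrePoly_injective (u₀ : ℂ)
    (hA : Function.Injective (aeval (laurentSlice κ A u₀) :
      MvPolynomial (Fin s) ℂ →ₐ[ℂ] MvPolynomial (Fin s) ℂ)) :
    Function.Injective (aeval (fibreSlice (laurentFibrePoly κ c A) u₀) :
      MvPolynomial (Fin s) ℂ →ₐ[ℂ] MvPolynomial (Fin s) ℂ) := by
  rw [fibreSlice_laurentFibrePoly, aeval_C_add_injective_iff]
  exact hA

/-- **On the torus and for `K ≤ κⱼ` the polynomial form is the problem side's inverse-power form.**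
[folklore] -/
theorem laurentFibreVariety_inter_torusLocus_eq (hK : ∀ j, K ≤ κ j) :
    laurentFibreVariety M b c₀ κ c A ∩ torusLocus ℂ (s + 1) =
      {z : Fin (s + 1) ⊕ Fin (s + 1) → ℂ |
        z (Sum.inl (Fin.last s)) =
          ∑ i, ∑ l, M i l * z (Sum.inl (Fin.castSucc i)) * z (Sum.inl (Fin.castSucc l)) +
            ∑ i, b i * z (Sum.inl (Fin.castSucc i)) + c₀ ∧
        ∀ j : Fin s, z (Sum.inr (Fin.castSucc j)) = z (Sum.inr (Fin.last s)) ^ (κ j) *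
          (c j + ∑ i : Fin K, eval (fun l => z (Sum.inl (Fin.castSucc l))) (A j i) *
            (z (Sum.inr (Fin.last s)) ^ ((i : ℕ) + 1))⁻¹)} ∩ torusLocus ℂ (s + 1) := by
  ext z
  have key : z ∈ torusLocus ℂ (s + 1) → ∀ j : Fin s,
      c j * z (Sum.inr (Fin.last s)) ^ (κ j) +
        ∑ i : Fin K, eval (fun l => z (Sum.inl (Fin.castSucc l))) (A j i) *
          z (Sum.inr (Fin.last s)) ^ (κ j - ((i : ℕ) + 1)) =
      z (Sum.inr (Fin.last s)) ^ (κ j) *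
        (c j + ∑ i : Fin K, eval (fun l => z (Sum.inl (Fin.castSucc l))) (A j i) *
          (z (Sum.inr (Fin.last s)) ^ ((i : ℕ) + 1))⁻¹) := by
    intro ht j
    have hu : z (Sum.inr (Fin.last s)) ≠ 0 := ht (Fin.last s)
    have hterm : ∀ i : Fin K, eval (fun l => z (Sum.inl (Fin.castSucc l))) (A j i) *
        z (Sum.inr (Fin.last s)) ^ (κ j - ((i : ℕ) + 1)) =
        z (Sum.inr (Fin.last s)) ^ (κ j) * (eval (fun l => z (Sum.inl (Fin.castSucc l))) (A j i) *
          (z (Sum.inr (Fin.last s)) ^ ((i : ℕ) + 1))⁻¹) := by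
      intro i
      have hle : (i : ℕ) + 1 ≤ κ j := by have := hK j; omega
      rw [pow_sub₀ _ hu hle]
      ring
    rw [Finset.sum_congr rfl fun i _ => hterm i, ← Finset.mul_sum]
    ring
  constructor
  · rintro ⟨⟨hb, hf⟩, ht⟩
    exact ⟨⟨hb, fun j => by rw [hf j, key ht j]⟩, ht⟩
  · rintro ⟨⟨hb, hf⟩, ht⟩
    exact ⟨⟨hb, fun j => by rw [hf j, key ht j]⟩, ht⟩

/-- Hence the two forms have the same exponential points (`Γ_exp ⊆ Gⁿ`). [folklore] -/
theorem laurentFibreVariety_inter_expGraph_eq (hK : ∀ j, K ≤ κ j) :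
    laurentFibreVariety M b c₀ κ c A ∩ expGraph ℂ (s + 1) =
      {z : Fin (s + 1) ⊕ Fin (s + 1) → ℂ |
        z (Sum.inl (Fin.last s)) =
          ∑ i, ∑ l, M i l * z (Sum.inl (Fin.castSucc i)) * z (Sum.inl (Fin.castSucc l)) +
            ∑ i, b i * z (Sum.inl (Fin.castSucc i)) + c₀ ∧
        ∀ j : Fin s, z (Sum.inr (Fin.castSucc j)) = z (Sum.inr (Fin.last s)) ^ (κ j) *
          (c j + ∑ i : Fin K, eval (fun l => z (Sum.inl (Fin.castSucc l))) (A j i) *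
            (z (Sum.inr (Fin.last s)) ^ ((i : ℕ) + 1))⁻¹)} ∩ expGraph ℂ (s + 1) := by
  have hE : expGraph ℂ (s + 1) = torusLocus ℂ (s + 1) ∩ expGraph ℂ (s + 1) :=
    (Set.inter_eq_right.mpr expGraph_subset_torusLocus).symm
  rw [hE, ← Set.inter_assoc, ← Set.inter_assoc, laurentFibreVariety_inter_torusLocus_eq M b c₀ κ c A hK]

/-- **Dominant slice, `M + Mᵀ ≠ 0` ⇒ the Laurent-fibre variety satisfies the seven hypotheses of
`ECCell (s+1) s`** (binders in order). [folklore] -/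
theorem ecCell_hypotheses_laurentFibreVariety (u₀ : ℂ)
    (hA : Function.Injective (aeval (laurentSlice κ A u₀) :
      MvPolynomial (Fin s) ℂ →ₐ[ℂ] MvPolynomial (Fin s) ℂ))
    (hM : ∃ i j, M i j + M j i ≠ 0) :
    IsIrreducibleClosed ℂ (laurentFibreVariety M b c₀ κ c A) ∧
    (laurentFibreVariety M b c₀ κ c A ∩ torusLocus ℂ (s + 1)).Nonempty ∧
    IsRotund ℂ (s + 1) (laurentFibreVariety M b c₀ κ c A ∩ torusLocus ℂ (s + 1)) ∧
    IsAddFree ℂ (s + 1) (laurentFibreVariety M b c₀ κ c A ∩ torusLocus ℂ (s + 1)) ∧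
    IsMulFree ℂ (s + 1) (laurentFibreVariety M b c₀ κ c A ∩ torusLocus ℂ (s + 1)) ∧
    zariskiDim ℂ (laurentFibreVariety M b c₀ κ c A) = (s + 1 : ℕ) ∧
    addProjDim ℂ (s + 1) (laurentFibreVariety M b c₀ κ c A) = (s : ℕ) := by
  obtain ⟨i, j, hij⟩ := hM
  rw [laurentFibreVariety_eq_graphFibreVariety]
  exact ecCell_hypotheses_graphFibreVariety _ _ u₀
    (fibreSlice_laurentFibrePoly_injective κ c A u₀ hA) (two_le_totalDegree_quadPoly M b c₀ hij)

/-- **Dominant slice, `s ≥ 1`, aperiodic quadric ⇒ member of `ECCellAperiodic s`** (seven binders in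
order). [folklore] -/
theorem ecCellAperiodic_hypotheses_laurentFibreVariety (hs : 0 < s) (u₀ : ℂ)
    (hA : Function.Injective (aeval (laurentSlice κ A u₀) :
      MvPolynomial (Fin s) ℂ →ₐ[ℂ] MvPolynomial (Fin s) ℂ))
    (haper : ¬ ∃ w : Fin (s + 1) → ℤ, w ≠ 0 ∧
      (∀ i, ∑ j, (M i j + M j i) * (w (Fin.castSucc j) : ℂ) = 0) ∧
      ∑ i, b i * (w (Fin.castSucc i) : ℂ) = (w (Fin.last s) : ℂ)) :
    IsIrreducibleClosed ℂ (laurentFibreVariety M b c₀ κ c A) ∧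
    (laurentFibreVariety M b c₀ κ c A ∩ torusLocus ℂ (s + 1)).Nonempty ∧
    IsAddFree ℂ (s + 1) (laurentFibreVariety M b c₀ κ c A ∩ torusLocus ℂ (s + 1)) ∧
    IsMulFree ℂ (s + 1) (laurentFibreVariety M b c₀ κ c A ∩ torusLocus ℂ (s + 1)) ∧
    zariskiDim ℂ (laurentFibreVariety M b c₀ κ c A) = (s + 1 : ℕ) ∧
    addProjDim ℂ (s + 1) (laurentFibreVariety M b c₀ κ c A) = (s : ℕ) ∧
    ¬ HasIntegerPeriod ℂ (projAdd '' (laurentFibreVariety M b c₀ κ c A ∩ torusLocus ℂ (s + 1))) := by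
  rw [← hasIntegerPeriod_graphBase_quadPoly_iff] at haper
  rw [laurentFibreVariety_eq_graphFibreVariety]
  exact ecCellAperiodic_hypotheses_graphFibreVariety _ _ u₀
    (fibreSlice_laurentFibrePoly_injective κ c A u₀ hA) hs haper

/-- **Dominant slice, `M + Mᵀ ≠ 0`, periodic quadric ⇒ member of `ECCellPeriodic s`** (eight binders
in order). [folklore] -/
theorem ecCellPeriodic_hypotheses_laurentFibreVariety (u₀ : ℂ)
    (hA : Function.Injective (aeval (laurentSlice κ A u₀) :
      MvPolynomial (Fin s) ℂ →ₐ[ℂ] MvPolynomial (Fin s) ℂ))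
    (hM : ∃ i j, M i j + M j i ≠ 0)
    (hper : ∃ w : Fin (s + 1) → ℤ, w ≠ 0 ∧
      (∀ i, ∑ j, (M i j + M j i) * (w (Fin.castSucc j) : ℂ) = 0) ∧
      ∑ i, b i * (w (Fin.castSucc i) : ℂ) = (w (Fin.last s) : ℂ)) :
    IsIrreducibleClosed ℂ (laurentFibreVariety M b c₀ κ c A) ∧
    (laurentFibreVariety M b c₀ κ c A ∩ torusLocus ℂ (s + 1)).Nonempty ∧
    IsRotund ℂ (s + 1) (laurentFibreVariety M b c₀ κ c A ∩ torusLocus ℂ (s + 1)) ∧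
    IsAddFree ℂ (s + 1) (laurentFibreVariety M b c₀ κ c A ∩ torusLocus ℂ (s + 1)) ∧
    IsMulFree ℂ (s + 1) (laurentFibreVariety M b c₀ κ c A ∩ torusLocus ℂ (s + 1)) ∧
    zariskiDim ℂ (laurentFibreVariety M b c₀ κ c A) = (s + 1 : ℕ) ∧
    addProjDim ℂ (s + 1) (laurentFibreVariety M b c₀ κ c A) = (s : ℕ) ∧
    HasIntegerPeriod ℂ (projAdd '' (laurentFibreVariety M b c₀ κ c A ∩ torusLocus ℂ (s + 1))) := by
  obtain ⟨i, j, hij⟩ := hM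
  rw [← hasIntegerPeriod_graphBase_quadPoly_iff] at hper
  rw [laurentFibreVariety_eq_graphFibreVariety]
  exact ecCellPeriodic_hypotheses_graphFibreVariety _ _ u₀
    (fibreSlice_laurentFibrePoly_injective κ c A u₀ hA) (two_le_totalDegree_quadPoly M b c₀ hij) hper

/-- `ECCell (s+1) s` ⇒ the Laurent-fibre variety meets `Γ_exp`. [folklore] -/
theorem laurentFibreVariety_inter_expGraph_nonempty_of_ecCell (u₀ : ℂ)
    (hA : Function.Injective (aeval (laurentSlice κ A u₀) :
      MvPolynomial (Fin s) ℂ →ₐ[ℂ] MvPolynomial (Fin s) ℂ))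
    (hM : ∃ i j, M i j + M j i ≠ 0) (h : ECCell (s + 1) s) :
    (laurentFibreVariety M b c₀ κ c A ∩ expGraph ℂ (s + 1)).Nonempty := by
  obtain ⟨h1, h2, h3, h4, h5, h6, h7⟩ :=
    ecCell_hypotheses_laurentFibreVariety M b c₀ κ c A u₀ hA hM
  exact h _ h1 h2 h3 h4 h5 h6 h7

/-- `ECCellAperiodic s` ⇒ the Laurent-fibre variety meets `Γ_exp`. [folklore] -/
theorem laurentFibreVariety_inter_expGraph_nonempty_of_ecCellAperiodic (hs : 0 < s) (u₀ : ℂ)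
    (hA : Function.Injective (aeval (laurentSlice κ A u₀) :
      MvPolynomial (Fin s) ℂ →ₐ[ℂ] MvPolynomial (Fin s) ℂ))
    (haper : ¬ ∃ w : Fin (s + 1) → ℤ, w ≠ 0 ∧
      (∀ i, ∑ j, (M i j + M j i) * (w (Fin.castSucc j) : ℂ) = 0) ∧
      ∑ i, b i * (w (Fin.castSucc i) : ℂ) = (w (Fin.last s) : ℂ))
    (h : ECCellAperiodic s) :
    (laurentFibreVariety M b c₀ κ c A ∩ expGraph ℂ (s + 1)).Nonempty := by
  obtain ⟨h1, h2, h3, h4, h5, h6, h7⟩ :=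
    ecCellAperiodic_hypotheses_laurentFibreVariety M b c₀ κ c A hs u₀ hA haper
  exact h _ h1 h2 h3 h4 h5 h6 h7

/-- `ECCellPeriodic s` ⇒ the Laurent-fibre variety meets `Γ_exp`. [folklore] -/
theorem laurentFibreVariety_inter_expGraph_nonempty_of_ecCellPeriodic (u₀ : ℂ)
    (hA : Function.Injective (aeval (laurentSlice κ A u₀) :
      MvPolynomial (Fin s) ℂ →ₐ[ℂ] MvPolynomial (Fin s) ℂ))
    (hM : ∃ i j, M i j + M j i ≠ 0)
    (hper : ∃ w : Fin (s + 1) → ℤ, w ≠ 0 ∧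
      (∀ i, ∑ j, (M i j + M j i) * (w (Fin.castSucc j) : ℂ) = 0) ∧
      ∑ i, b i * (w (Fin.castSucc i) : ℂ) = (w (Fin.last s) : ℂ))
    (h : ECCellPeriodic s) :
    (laurentFibreVariety M b c₀ κ c A ∩ expGraph ℂ (s + 1)).Nonempty := by
  obtain ⟨h1, h2, h3, h4, h5, h6, h7, h8⟩ :=
    ecCellPeriodic_hypotheses_laurentFibreVariety M b c₀ κ c A u₀ hA hM hper
  exact h _ h1 h2 h3 h4 h5 h6 h7 h8

/-- **Exponential points of the Laurent-fibre variety ↔ solutions of**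
`exp xⱼ = cⱼ (e^{g})^{κⱼ} + Σᵢ A_{j,i}(x) (e^{g})^{κⱼ-(i+1)}` (polynomial form). [folklore] -/
theorem laurentFibreVariety_inter_expGraph_nonempty_iff :
    (laurentFibreVariety M b c₀ κ c A ∩ expGraph ℂ (s + 1)).Nonempty ↔
      ∃ x : Fin s → ℂ, ∀ j, Complex.exp (x j) =
        c j * Complex.exp (∑ i, ∑ l, M i l * x i * x l + ∑ i, b i * x i + c₀) ^ (κ j) +
          ∑ i : Fin K, eval x (A j i) *
            Complex.exp (∑ i, ∑ l, M i l * x i * x l + ∑ i, b i * x i + c₀) ^ (κ j - ((i : ℕ) + 1)) := by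
  rw [laurentFibreVariety_eq_graphFibreVariety, graphFibreVariety_inter_expGraph_nonempty_iff]
  refine exists_congr fun x => forall_congr' fun j => ?_
  simp only [eval_quadPoly, quadFun, laurentFibrePoly, map_add, map_sum, map_mul, map_pow, eval_C,
    eval_X, Fin.cons_zero, eval_rename, cons_comp_succ]

/-- **… ↔ solutions of the problem-side system** `exp xⱼ = (e^{g})^{κⱼ}(cⱼ + Σᵢ A_{j,i}(x)(e^{g})^{-(i+1)})`
(`K ≤ κⱼ`) — EXACTLY the conclusion of `Summit.….exists_expPoint_quadricEscape_laurent`. [folklore] -/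
theorem laurentFibreVariety_inter_expGraph_nonempty_iff' (hK : ∀ j, K ≤ κ j) :
    (laurentFibreVariety M b c₀ κ c A ∩ expGraph ℂ (s + 1)).Nonempty ↔
      ∃ x : Fin s → ℂ, ∀ j, Complex.exp (x j) =
        Complex.exp (∑ i, ∑ l, M i l * x i * x l + ∑ i, b i * x i + c₀) ^ (κ j) *
          (c j + ∑ i : Fin K, eval x (A j i) *
            (Complex.exp (∑ i, ∑ l, M i l * x i * x l + ∑ i, b i * x i + c₀) ^ ((i : ℕ) + 1))⁻¹) := by
  rw [laurentFibreVariety_inter_expGraph_nonempty_iff]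
  refine exists_congr fun x => forall_congr' fun j => ?_
  set u : ℂ := Complex.exp (∑ i, ∑ l, M i l * x i * x l + ∑ i, b i * x i + c₀) with hu
  have hu0 : u ≠ 0 := Complex.exp_ne_zero _
  have hterm : ∀ i : Fin K, eval x (A j i) * u ^ (κ j - ((i : ℕ) + 1)) =
      u ^ (κ j) * (eval x (A j i) * (u ^ ((i : ℕ) + 1))⁻¹) := by
    intro i
    have hle : (i : ℕ) + 1 ≤ κ j := by have := hK j; omega
    rw [pow_sub₀ _ hu0 hle]
    ring
  have key : c j * u ^ (κ j) + ∑ i : Fin K, eval x (A j i) * u ^ (κ j - ((i : ℕ) + 1)) =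
      u ^ (κ j) * (c j + ∑ i : Fin K, eval x (A j i) * (u ^ ((i : ℕ) + 1))⁻¹) := by
    rw [Finset.sum_congr rfl fun i _ => hterm i, ← Finset.mul_sum]
    ring
  rw [key]

end LaurentFibres

/-! ### A certified member over Mantova–Masser's isotropic base with a `yₙ`-nonlinear fibre -/

section IsotropicPowerModel

/-- The coefficient matrix `diag(1, -1)` of Mantova–Masser's isotropic base `x₃ = x₁² - x₂²`.
[cite: MantovaMasser2023, §1 p. 5 (42)] -/
def mmIsotropicMatrix : Fin 2 → Fin 2 → ℂ := ![![1, 0], ![0, -1]]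

/-- The dominant (involutive) fibre offsets `A = (x₁, -x₂)`. [folklore] -/
def mmPowerOffsets : Fin 2 → MvPolynomial (Fin 2) ℂ := ![X 0, -X 1]

/-- **The isotropic power model** `{x₃ = x₁² - x₂², y₁ = y₃² + x₁, y₂ = y₃ - x₂} ⊆ ℂ³ × ℂ³`: the
problem side's `isotropicBase_powerFibre_model_system_solvable` 3-fold, as a monomial-fibre variety
(`κ = (2, 1)`, `c = (1, 1)`; `κᵀMκ = 3 ≠ 0` although the base is isotropic in the diagonal direction).
[cite: MantovaMasser2023, §1 p. 5 (42)] -/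
def isotropicPowerModel : Set (Fin 3 ⊕ Fin 3 → ℂ) :=
  powerFibreVariety mmIsotropicMatrix 0 0 ![2, 1] ![1, 1] mmPowerOffsets

/-- `A = (x₁, -x₂)` is an involution of `ℂ[x₁, x₂]`, hence dominant. [folklore] -/
theorem aeval_mmPowerOffsets_injective :
    Function.Injective (aeval mmPowerOffsets : MvPolynomial (Fin 2) ℂ →ₐ[ℂ] MvPolynomial (Fin 2) ℂ) := by
  have hcomp : (aeval mmPowerOffsets : MvPolynomial (Fin 2) ℂ →ₐ[ℂ] MvPolynomial (Fin 2) ℂ).comp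
      (aeval mmPowerOffsets) = AlgHom.id ℂ _ := by
    refine MvPolynomial.algHom_ext fun j => ?_
    fin_cases j <;> simp [mmPowerOffsets]
  have hleft : Function.LeftInverse (aeval mmPowerOffsets : MvPolynomial (Fin 2) ℂ →ₐ[ℂ] _)
      (aeval mmPowerOffsets) := fun p => by
    simpa using congrArg (fun f => f p) hcomp
  exact hleft.injective

/-- The isotropic base `x₃ = x₁² - x₂²` passes the integer aperiodicity test of
`hasIntegerPeriod_graphBase_quadPoly_iff` (`M + Mᵀ = diag(2, -2)` is invertible, `b = 0`). [folklore] -/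
theorem mmIsotropic_integerTest :
    ¬ ∃ w : Fin (2 + 1) → ℤ, w ≠ 0 ∧
      (∀ i, ∑ j, (mmIsotropicMatrix i j + mmIsotropicMatrix j i) * (w (Fin.castSucc j) : ℂ) = 0) ∧
      ∑ i, (0 : Fin 2 → ℂ) i * (w (Fin.castSucc i) : ℂ) = (w (Fin.last 2) : ℂ) := by
  rintro ⟨w, hw, hM, hb⟩
  have h0 := hM 0
  have h1 := hM 1
  simp only [mmIsotropicMatrix, Fin.sum_univ_two, Matrix.cons_val_zero, Matrix.cons_val_one,
    Pi.zero_apply, zero_mul, add_zero, zero_add] at h0 h1 hb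
  have hw0 : w (Fin.castSucc 0) = 0 := by
    have : (2 : ℂ) * (w (Fin.castSucc 0) : ℂ) = 0 := by linear_combination h0
    exact_mod_cast (mul_eq_zero.1 this).resolve_left two_ne_zero
  have hw1 : w (Fin.castSucc 1) = 0 := by
    have : (2 : ℂ) * (w (Fin.castSucc 1) : ℂ) = 0 := by linear_combination -h1
    exact_mod_cast (mul_eq_zero.1 this).resolve_left two_ne_zero
  have hw2 : w (Fin.last 2) = 0 := by exact_mod_cast hb.symm
  apply hw
  funext i
  induction i using Fin.lastCases with
  | last => exact hw2
  | cast j =>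
    fin_cases j
    · exact hw0
    · exact hw1

/-- **The isotropic power model is a certified member of `ECCellAperiodic 2`** (seven binders in
order). [folklore] -/
theorem ecCellAperiodic_hypotheses_isotropicPowerModel :
    IsIrreducibleClosed ℂ isotropicPowerModel ∧
    (isotropicPowerModel ∩ torusLocus ℂ 3).Nonempty ∧
    IsAddFree ℂ 3 (isotropicPowerModel ∩ torusLocus ℂ 3) ∧
    IsMulFree ℂ 3 (isotropicPowerModel ∩ torusLocus ℂ 3) ∧
    zariskiDim ℂ isotropicPowerModel = (3 : ℕ) ∧
    addProjDim ℂ 3 isotropicPowerModel = (2 : ℕ) ∧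
    ¬ HasIntegerPeriod ℂ (projAdd '' (isotropicPowerModel ∩ torusLocus ℂ 3)) :=
  ecCellAperiodic_hypotheses_powerFibreVariety mmIsotropicMatrix 0 0 ![2, 1] ![1, 1] mmPowerOffsets
    two_pos aeval_mmPowerOffsets_injective mmIsotropic_integerTest

/-- `ECCellAperiodic 2` ⇒ the isotropic power model meets `Γ_exp`. [folklore] -/
theorem isotropicPowerModel_inter_expGraph_nonempty_of_ecCellAperiodic (h : ECCellAperiodic 2) :
    (isotropicPowerModel ∩ expGraph ℂ 3).Nonempty :=
  powerFibreVariety_inter_expGraph_nonempty_of_ecCellAperiodic mmIsotropicMatrix 0 0 ![2, 1] ![1, 1]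
    mmPowerOffsets two_pos aeval_mmPowerOffsets_injective mmIsotropic_integerTest h

/-- **Exponential points of the isotropic power model ↔ solutions of**
`e^z = e^{2(z² - w²)} + z ∧ e^w = e^{z² - w²} - w` — the problem side's model system, verbatim.
[folklore] -/
theorem isotropicPowerModel_inter_expGraph_nonempty_iff :
    (isotropicPowerModel ∩ expGraph ℂ 3).Nonempty ↔
      ∃ z w : ℂ, Complex.exp z = Complex.exp (2 * (z ^ 2 - w ^ 2)) + z ∧
        Complex.exp w = Complex.exp (z ^ 2 - w ^ 2) - w := by
  rw [isotropicPowerModel, powerFibreVariety_inter_expGraph_nonempty_iff]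
  have hsq : ∀ q : ℂ, Complex.exp q ^ 2 = Complex.exp (2 * q) := fun q => by
    rw [sq, ← Complex.exp_add, two_mul]
  have key : ∀ x : Fin 2 → ℂ,
      (∀ j, Complex.exp (x j) = (![1, 1] : Fin 2 → ℂ) j *
        Complex.exp (∑ i, ∑ l, mmIsotropicMatrix i l * x i * x l + ∑ i, (0 : Fin 2 → ℂ) i * x i + 0) ^
          ((![2, 1] : Fin 2 → ℕ) j) + eval x (mmPowerOffsets j)) ↔
      (Complex.exp (x 0) = Complex.exp (2 * (x 0 ^ 2 - x 1 ^ 2)) + x 0 ∧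
        Complex.exp (x 1) = Complex.exp (x 0 ^ 2 - x 1 ^ 2) - x 1) := by
    intro x
    have hg : ∑ i, ∑ l, mmIsotropicMatrix i l * x i * x l + ∑ i, (0 : Fin 2 → ℂ) i * x i + 0 =
        x 0 ^ 2 - x 1 ^ 2 := by
      simp [mmIsotropicMatrix, Fin.sum_univ_two]
      ring
    rw [Fin.forall_fin_two, hg]
    simp [mmPowerOffsets, hsq, sub_eq_add_neg]
  constructor
  · rintro ⟨x, hx⟩
    exact ⟨x 0, x 1, (key x).1 hx⟩
  · rintro ⟨z, w, hzw⟩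
    refine ⟨![z, w], (key ![z, w]).2 ?_⟩
    simpa using hzw

end IsotropicPowerModel

end Literature.ModelTheory.Zilber
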